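import Literature.MathematicalPhysics.QuantumFieldTheory.Balaban1983to89.T4BankedInduction

/-!
# `Balaban1983to89.T4PrintedShapeBanking` — THE PRINTED-SHAPE MODEL INHABITS THE BANKING HYPOTHESES: print's per-step
costs (booked PER EVENT WINDOW, v1.1), credits, banks and reserves on the persistence dictionary's events, ONE infrared
threshold, uniform in the cutoff, under which all four binders of `…T4BankedInduction.Banking` hold along any run of
the typed flow, and the HISTORY-TREE BOOKING IDENTITY (cell `pub-balaban`, node U5c / spine estimate NE7b, COUNT
member P1; journal CLAIM T4-U5c.E-NE7b-PRINTEDSHAPE-K* (v1, gen 9) and T4-U5c.E-NE7b-PRINTEDSHAPE-v1.1* (v1.1/v1.2, gen 10),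
unit `b2b-balaban-t4-ne7b-p1`, the lineage of `…T4PersistentHistoryCount` / `…T4PersistenceDictionary` /
`…T4LiveStructureGas` / `…T4BankedInduction`; companion record `t4/T4-EST-NE7b-P1.md` v1.10; imports
`…T4BankedInduction` (v1.1) ONLY and modifies nothing)

VERSION v1.1 (cross-read C-pv10-98 of v1: objection O2 and DOCFIX D2).  v1 booked the per-step control cost of a
structure as ONE size-free floor per step of the genealogy's hull `[min rootStep, reach)` plus the size costs
(`cost G n = floorK n + Σ sz`); hence for a merger of two COEXISTING structures the pre-merger floor of the second
partner was not booked in the merged life cost — the reader's kernel witness `xread3/TwinC.lean` §(C4): `lifeCost Z =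
9` hull floors against `10` floors incurred by the history tree — although the partners' own credits pay it (v1's
`merge_geom` discarded it as slack): the priced quantity of §6 did not dominate the tree-booked cost of a merged
history.  v1.1 is the reader's repair (R-a), PER-EVENT WINDOW FLOORS: every event books the floor on ITS OWN placed
window (§2 `wfloor`, `cost`; `Gen.place` of `…T4PersistenceDictionary`: births at their step, renewals at the step
`h + 1` the renewed component appears, mergers at the later partner reach), so that the booking is ADDITIVE over the
disjoint event sets of coexisting structures (§2 `cost_renew_eq`, `cost_merge_eq`) and lives on the structure's own
life (§3 `Consistent.cost_eq_zero`); the merger-geometry binder becomes the EXACT DECOMPOSITION `lifeCost (merge X Y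
e) = lifeCost X + lifeCost Y + extn X Y e` (§4 `lifeCost_merge_eq`); and the aggregation clause the reader found
FALSE for v1's booking — the history tree's per-structure costs are dominated by the final life cost — is an IDENTITY
for the booked costs (§7 `treeCost_eq`, `treeCost_reach`) and a THEOREM for the floors: every living structure pays its
floor at every step of its life (§2 `floorK_le_cost`, the dictionary's cover theorem `Gen.cover`), so the history
tree's floor count — one floor per structure per step of its existence — is at most the final life cost (§7
`treeFloor_le_treeCost`, `treeFloor_le_lifeCost`).  The statements of `banking_printedShape`, `banking_printedShape_of_flow`,
`exists_irThreshold`, `printedShape_recordPrice`, `root_price` are UNCHANGED (same constants, same threshold: the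
credits already paid every floor); `renew_past_holds` (for the steps `n ≤ h` the binder asks; an equality,
`renew_past_eq`) and `renew_holds` use the renewal's `Gen.WF` (the renewal is a NEW event), which the binders provide.
v1's merged-life interval lemma (§1), superseded by the exact decomposition, is removed.  DOCFIX D2: the paragraph
WHAT THIS DOES AND DOES NOT SETTLE states the booking liberties exactly.  §8 re-decides the reader's genealogy under
the new booking: `lifeCost Z = 4 + 4 + 3 = 11 = 3 + 1 + 7` (tree-booked costs) `≥ 3 + 1 + 6 = 10 = treeFloor Z reach`
(the reader's floor count; v1 priced `9 < 10`).

HONEST FRAMING (cell `pub-balaban`, T4-DAG PAGE 1).  The cell's T4 target is the existence AND uniqueness of the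
`ε → 0` limit of Bałaban's unit-scale block-averaged expectations on a FIXED finite four-torus — rung (B)+1, strictly
beyond ultraviolet stability ([Balaban1989LargeFieldII] Thm 1 p. 355, [Balaban1988Convergent] Cor. 3 p. 264); it is NOT
infinite volume, NOT a mass gap, NOT the Clay problem, and it is CONDITIONAL on BetaPertH, (B), (B^μ), which stay
binders of the consumer and are used nowhere in this module.  This module is [folklore] real arithmetic and finite sums
(zero `sorry`, zero cite-tagged hypothesis, no `def … : Prop` fact of Bałaban's).  B16 = [Balaban1989LargeFieldII] is a
manuscript UNDER AUDIT: the page pointers and the sentences quoted below LOCATE which printed shape each definition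
models (they repeat quotations certified in `t4/T4-XREAD-NE7b-READING.md` v1.1 / `t4/T4-XREAD-U5c.md`, carried by the
imported modules, and — the one sentence of p. 387 new in v1.1 — in `t4/CITED-FACTS-T4.md` F-T4-49 [R p033]); they are
never used as establishing a disputed step.  Value = kernel bookkeeping around a located gap; NOT an estimate of
Bałaban's, NOT NE7b, NOT summit progress.

WHY THIS MODULE.  `…T4BankedInduction` (v1.1) proves print's (1.80) induction with the slack kept, `banked_induction :
adm G → G.WF W → lifeCost + banks + reserve root ≤ credits`, from FOUR window-local binders (`Banking.born`, `.renew_past`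
+ `.renew`, `.merge_geom`, `.merge_pay`) over ABSTRACT data and an admissibility predicate `adm` (cross-read C-pv20-57,
objection O1: unguarded binders exclude print-shaped data).  Its §5 inhabits the binders only by a FLAT toy.  This module
inhabits them by DATA OF THE PRINTED SHAPES on the dictionary's own event type `PEv = (step, kind, d′)` and window
table `dictW R n₁` (`…T4PersistenceDictionary`), along a run `(R s, g s)_{s ≤ K}` of the typed flow — so that the four
binders are tested JOINTLY against the real scale dependence `R_s ↔ p₀(g_s)`, uniformly in the cutoff `K`:
* per-step CONTROL COST of a structure at step `n ≤ K` (§2 `cost`), booked PER EVENT (v1.1): for EVERY event `e` of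
  the structure, the size-free FLOOR `E₂·R_n^{q′}` on the event's OWN window `[place e, place e + W e)` — the summand
  of (1.80) p. 384 for a small domain, «d′_n(S^{n−j}(Z)) ≤ (64)^d if it is equal to 0» (p. 384), `q′` standing for
  print's `d + 1`; the placement `Gen.place` is the dictionary's: a birth's window at its step («Thus K ≤ n₀ − j + R_j»
  p. 385), a renewal's at the step `h + 1` at which the renewed component appears («hence K = R_{j+1} for Z» p. 386),
  a merger's at the later partner reach («and that K ≤ K₂ + n₁ + R_{j+1}» p. 387) — PLUS, for every birth `b = (j, 0,
  d′)` among the structure's events, the DECAYING SIZE COST `E₃·R_n^{q′}·(d′+1)·2^{−(n−j)}` on the fat epoch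
  `j < n ≤ j + fatWait d′` — the first sum of (1.81) p. 385 «Σ_{n=j+1}^{n₀} O(1)M^dR_n^{d+1}3(126)^d2^{−(n−j)}d′_j(Z)», with
  the dictionary's reading `fatWait` of «d′_n(Z^{(n−j)}) ≤ L^{−1/2(n−j)}d′_j(Z) ≤ 2^{−(n−j)}d′_j(Z)», stated «for n − j > 1»
  (pp. 384–385) — PLUS, for every merger event, a CONNECTOR of fatness class `dC` decaying likewise (print's
  «d′_{j+1}(X) + d′_{j+1}(Y) + 2d ≥ d′_{j+1}(Z),» p. 386: the merged domain may be fatter than its parts by `2d`; `dC`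
  stands for that `2d`).  Two structures coexisting before their merger thus book a floor EACH (their event sets are
  disjoint, `Gen.WF`), and at a post-merger step before both partners' horizons the merged structure books both
  partners' floors — print's «This implies that d′_n(S^{n−j−1}(Z)) ≤ d′_n(S^{n−j−1}(X)) + d′_n(S^{n−j−1}(Y)).» (p. 387,
  F-T4-49) read inside the identification (ID-a), a harmless over-charge paid by the partners' own credits;
* RAW CREDITS (§2 `credit`): a birth of class `d′` at step `j` carries the (1.79) exponent «exp(−½γ₀A₁²p₀²(g_j)(d′_j(Z_j^{(i)})
  + 1) − 2p₀(g_j))» as `a·p₀(g_j)²·(d′+1) + 2p₀(g_j)`; a renewal event at step `h + 1` carries the «new factor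
  exp(−p₀(g_j))» (p. 386), `j = h`, as `p₀(g_h)`; a merger carries `0`;
* BANKS `κ₁·W e + E e` with `E` (§2 `Emarg`) `= Eb + μ(d′+1)` at births and `E₀` at renewals / mergers (the count
  carrier's `ρ` / `η` margins); RESERVES `2p₀(g_j)` at births, `0` else; merger EXTENSION (§2 `extn`) = the floor over the
  merger window beyond the later partner reach («K ≤ K₂ + n₁ + R_{j+1}» p. 387) + the connector;
* ADMISSIBILITY `Consistent` (§3) = print's discipline READ (ID): a birth event sits at its own step; a renewal event
  `(h+1, 1, ·)` happens AT READINESS `h + 1 = reach` (renewal is what happens to «components of Z_j satisfying the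
  conditions (i), (ii), for which some large fields are created during the preparatory steps» p. 383 — conditions (i),
  (ii) being readiness; «hence K = R_{j+1} for Z» p. 386); a merger event's step lies in BOTH partners' pending lives;
  all event steps are `≤ K`.  It is hereditary, and it implies (§3) that every event's size epoch AND every event's
  window lie inside the structure's own life `[rootStep, reach)` — so the booked cost vanishes off the life — and that
  the root of a structure is a birth at `rootStep`: the facts the binders need.
THE THEOREMS.  §4 `banking_printedShape`: nonnegativity (`Consts.Valid`, incl. `fatWait dC ≤ n₁` — «n₁ is a rather small
number, e.g., n₁ < 10» p. 387), the typed (2.9) first member `B14FlowStep.FlowIneq29` (`R_n ≤ L·R_m`, for the window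
sums), `1 ≤ R s`, and THREE SCALE-INDEXED PAY INEQUALITIES give `Banking (Consistent C K R) (dictW R C.n₁) cost credit
bank reserve extn`; the merger-geometry binder holds as the exact decomposition `lifeCost_merge_eq`.  The three pay
inequalities are LITERALLY the conclusions of `…T4BankedInduction.birthFactor_pays` (`E_f := Eb`, `E_b := 3E₂L^{q′} +
E₃L^{q′} + 3κ₁`, `q := q′+1`), `renewalFactor_pays` (`W := R + 1`, `F := 1`, `E₁ := 2E₂L^{q′}`) and `mergeSurplus_pays`
(`W := n₁ + R`, `F := n₁`, `E₁ := (1+n₁)E₂L^{q′} + dC·E₃L^{q′}`), so §5 `banking_printedShape_of_flow` derives the whole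
binder set from the typed (2.7) `B14.FlowIneq27`, the typed (2.5) `B14.IsRj`, the exponent condition `r(q′+1) ≤ p₀` (the
cell's (X7)), `1 ≤ log g_s⁻²`, and γ-CLAUSES ON `log g_K⁻²` ONLY; and §5 `exists_irThreshold` packages them: for fixed
symbolic constants there is ONE infrared value `x₀`, free of the cutoff, such that along EVERY run of the typed flow
with `log g_K⁻² ≥ x₀` the printed-shape data inhabit `Banking` — «for p₀ large and γ small enough» ((1.88) p. 387) made
exact, joint over the four cases, and `K`-uniform.  §6: every consistent well-formed genealogy then obeys the count
carrier's price shape `hy` (`…T4BankedInduction.rawFactor_le_recordPrice`), with `ρ_b = e^{−(2p₀(g_j) + Eb + μ(d′+1))}`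
for the root birth and `η_e = e^{−E e}`.  §7 (v1.1): the HISTORY-TREE BOOKING `treeCost G t` — every structure of the
genealogy's history tree (each constituent region while bare, each renewed and each merged component) charged its own
modelled cost `cost V n` from the step it appears until its successor appears, or until the cut `t` — EQUALS
`Σ_{n ∈ [rootStep, t)} cost G n` for consistent well-formed genealogies (`treeCost_eq`); in particular `treeCost G reach
= lifeCost G` (`treeCost_reach`): the life cost priced in §6 books every structure of the history at every step of its
existence; and the HISTORY-TREE FLOOR COUNT `treeFloor G t` (one floor `floorK n` per structure of the tree per step of
its segment) satisfies `treeFloor G t ≤ treeCost G t` for `t ≤ reach` (`treeFloor_le_treeCost`: every structure of the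
tree is alive on its segment and pays its floor, `floorK_le_cost`), hence `treeFloor G reach ≤ lifeCost G`
(`treeFloor_le_lifeCost`).  §8: non-vacuity of the joint guard `Consistent ∧ Gen.WF` (a genealogy with a renewal at
readiness and a merger, decided; a premature renewal is rejected), and the cross-read's two-partner genealogy
re-decided under the per-event booking (life cost `11` = tree-booked costs `3 + 1 + 7` ≥ the tree's floor count `10`,
decided; the partners' lives `4 + 4` + extension `3`).  v1.2 (gen 10, same cross-read, nothing else changed) adds the
floor comparison: §2 `floorK_le_cost`, §7 `treeFloor` / `treeFloor_le_treeCost` / `treeFloor_le_lifeCost`, §8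
`treeFloor_Z₀`.
KERNEL PIECES (§1–§3): the sum of a nonnegative function vanishing off a set; the per-event cost equations
`cost_born` / `cost_renew_eq` / `cost_merge_eq`; one floor per life step (`floorK_le_cost`, from the dictionary's
`Gen.cover`); window sums of the floor and of the decaying size cost through (2.9) and
`…T4PersistentHistoryCount.sum_half_pow_Ioc`; the `Consistent` invariants (`rootStep ≤ place e`, `place e + W e ≤
reach`, size epochs inside the life, hence `cost G n = 0` off the life; the root is a birth at `rootStep`).
WHAT THIS DOES AND DOES NOT SETTLE.  It answers O1 of C-pv20-57 with a kernel inhabitation witness on print's shapes,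
shows the four binders jointly satisfiable with `K`-free constants, and (v1.1, O2 of C-pv10-98) books every live
structure of a history at every step (`treeCost_eq`), at no less than its floor (`treeFloor_le_lifeCost`).  It does NOT
identify Bałaban's realised quantities with the
model: that the control cost of a live structure at step `n` is at most `cost G n` (in particular that a component
beyond its horizon, a renewed component, and a merged component `n₁` steps after the later horizon are SMALL domains,
that sizes are subadditive up to `2d`, and that the merged domain's per-step term before the partners' horizons is at
most the partners' terms, p. 387), that the realised small factors are the modelled credits, and that realised
histories are `Consistent` well-formed genealogies, are READINGS (ID)/R3′ of pp. 381–387 — [R]-grade, owned by the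
renewal member's obligation O-R10 and this lineage's (ID); the GAPS row G-ne7bp1g9-1 records exactly this residual.
BOOKING LIBERTIES, exactly (v1.1, DOCFIX D2): of the liberties listed in `…T4BankedInduction`, (S2) (renewal at any
pending step) is CLOSED here — `Consistent` pins the renewal to readiness `h + 1 = reach`; (S3) (the merger extension)
is INSTANTIATED as `extn` = merger-window floor + connector, whose identification with print's cost of the merged
domain beyond the later horizon is part of (ID-a); (S4) (merger credit `0`, the surplus booked as the absorbed root's
reserve) is in force; floors are booked per event window, so a merged structure books both partners' floors until
their horizons (print's subadditivity of sizes, p. 387 — an over-charge paid by the partners' own credits), and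
nothing is booked at steps beyond the cutoff `K` (not performed).  BetaPertH/(B)/(B^μ) are hidden in no definition
here: every `def` below is a polynomial / exponential expression in displayed symbols, a finite sum of such, or the
model's own admissibility predicate.
-/

open Finset

namespace Literature.MathematicalPhysics.QuantumFieldTheory.Balaban1983to89.T4PrintedShapeBanking

open Literature.MathematicalPhysics.QuantumFieldTheory.Balaban1983to89
open T4PersistenceDictionary T4PersistentHistoryCount T4BankedInduction

/-! ## §1 A finite-sum lemma: vanishing off a set -/

section Sums

/-- A nonnegative function vanishing off `T` sums over any `A` to at most its sum over `T`. [folklore] -/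
theorem sum_le_sum_of_vanish {A T : Finset ℕ} {f : ℕ → ℝ} (hf : ∀ n, 0 ≤ f n) (hz : ∀ n, n ∉ T → f n = 0) :
    ∑ n ∈ A, f n ≤ ∑ n ∈ T, f n := by
  rw [← Finset.sum_filter_ne_zero A]
  apply Finset.sum_le_sum_of_subset_of_nonneg
  · intro n hn
    rw [Finset.mem_filter] at hn
    by_contra h
    exact hn.2 (hz n h)
  · intro n _ _
    exact hf n

end Sums

/-! ## §2 The printed shapes on the dictionary's events -/

section Shapes

/-- **THE SYMBOLIC CONSTANTS** of the printed shapes (print fixes neither its `O(1)`'s nor `M`; the identification with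
print's constants is READING (ID)). [folklore] -/
structure Consts where
  /-- merger allowance `n₁` («n₁ is a rather small number, e.g., n₁ < 10» p. 387) -/
  n₁ : ℕ
  /-- connector class: the `2d` of «d′_{j+1}(X) + d′_{j+1}(Y) + 2d ≥ d′_{j+1}(Z),» p. 386 -/
  dC : ℕ
  /-- window power of the per-step floor: print's `d + 1` in (1.80) -/
  q' : ℕ
  /-- floor constant (print: `O(1)M^d` times the small-domain size `(64)^d`, p. 384) -/
  E₂ : ℝ
  /-- size constant (print: `O(1)M^d 3(126)^d` of (1.81) p. 385) -/
  E₃ : ℝ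
  /-- bank rate of the count carrier (`bank e = κ₁·W e + E e`) -/
  κ₁ : ℝ
  /-- bank margin of renewal and merger events (the carrier's `η`) -/
  E₀ : ℝ
  /-- bank margin base of births -/
  Eb : ℝ
  /-- fatness summability margin of births (the carrier's `ρ`) -/
  μ : ℝ
  /-- the quadratic birth constant: print's `½γ₀A₁²` of (1.79) -/
  a : ℝ
  /-- profile amplitude: `p₀(g) = A₀ (log g⁻²)^{p₀}` (`p0Profile`) -/
  A₀ : ℝ
  /-- profile exponent -/
  p₀ : ℕ

/-- Nonnegativity of the symbolic constants, and the connector's epoch fits the merger allowance. [folklore] -/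
structure Consts.Valid (C : Consts) : Prop where
  E₂_nonneg : 0 ≤ C.E₂
  E₃_nonneg : 0 ≤ C.E₃
  κ₁_nonneg : 0 ≤ C.κ₁
  E₀_nonneg : 0 ≤ C.E₀
  Eb_nonneg : 0 ≤ C.Eb
  μ_nonneg : 0 ≤ C.μ
  dC_le : fatWait C.dC ≤ C.n₁

variable (C : Consts) (K : ℕ) (R : ℕ → ℕ) (g : ℕ → ℝ)

/-- **THE FLOOR**: the size-free per-step control cost `E₂·R_n^{q′}` of a performed step `n ≤ K` (steps beyond the cutoff
are not performed and cost nothing). [folklore] -/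
noncomputable def floorK (n : ℕ) : ℝ := if n ≤ K then C.E₂ * (R n : ℝ) ^ C.q' else 0

/-- **SIZE WEIGHT** of an event: `d′ + 1` for a birth of class `d′`, the connector class `dC` for a merger, `0` for a
renewal (a renewed component is a small domain). [folklore] -/
noncomputable def wt (e : PEv) : ℝ :=
  if e.kind = 0 then (e.fat : ℝ) + 1 else if e.kind = 2 then (C.dC : ℝ) else 0

/-- **SIZE EPOCH LENGTH** of an event: `fatWait d′` for a birth, `fatWait dC` for a merger, `0` for a renewal. [folklore] -/
def fw (e : PEv) : ℕ := if e.kind = 0 then fatWait e.fat else if e.kind = 2 then fatWait C.dC else 0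

/-- **THE SIZE EPOCH** of an event at step `s`: the steps `s < n ≤ s + fw e` during which its images may still be fat.
[folklore] -/
def supp (e : PEv) : Finset ℕ := Finset.Ioc e.step (e.step + fw C e)

/-- **THE DECAYING SIZE COST** of an event: `E₃·R_n^{q′}·wt e·2^{−(n−s)}` on its size epoch (performed steps only),
`0` elsewhere — the first sum of (1.81) p. 385 per unit of size. [folklore] -/
noncomputable def sz (e : PEv) (n : ℕ) : ℝ :=
  if n ∈ supp C e ∧ n ≤ K then C.E₃ * (R n : ℝ) ^ C.q' * wt C e * (1 / 2 : ℝ) ^ (n - e.step) else 0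

/-- **THE WINDOW FLOOR OF AN EVENT** whose window is placed at step `p`: the floor on the event's own window
`[p, p + W e)`, `0` outside it (v1.1: the floor is booked per event, not per hull step). [folklore] -/
noncomputable def wfloor (p : ℕ) (e : PEv) (n : ℕ) : ℝ :=
  if n ∈ Finset.Ico p (p + dictW R C.n₁ e) then floorK C K R n else 0

/-- **THE PER-STEP CONTROL COST OF A STRUCTURE** at step `n` (v1.1, booked per event): every event of the structure
books the floor on its own placed window (`Gen.place`: births at their step, renewals at the step `h + 1` at which the
renewed component appears, mergers at the later partner reach) and its decaying size cost on its size epoch. [folklore] -/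
noncomputable def cost (G : Gen PEv) (n : ℕ) : ℝ :=
  ∑ e ∈ G.events, (wfloor C K R (G.place (dictW R C.n₁) e) e n + sz C K R e n)

/-- **THE RAW CREDITS**: the (1.79) birth exponent `a·p₀(g_j)²·(d′+1) + 2p₀(g_j)`, the renewal factor `p₀(g_h)` of an event
at step `h + 1`, and `0` for a merger. [folklore] -/
noncomputable def credit (e : PEv) : ℝ :=
  if e.kind = 0 then
    C.a * (p0Profile C.A₀ C.p₀ (g e.step)) ^ 2 * ((e.fat : ℝ) + 1) + 2 * p0Profile C.A₀ C.p₀ (g e.step)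
  else if e.kind = 1 then p0Profile C.A₀ C.p₀ (g (e.step - 1)) else 0

/-- **THE BANK MARGINS** `E e`: `Eb + μ(d′+1)` at births, `E₀` at renewals and mergers; the bank is `κ₁·W e + E e`.
[folklore] -/
noncomputable def Emarg (e : PEv) : ℝ := if e.kind = 0 then C.Eb + C.μ * ((e.fat : ℝ) + 1) else C.E₀

/-- **THE RESERVES**: a birth at step `j` sets `2p₀(g_j)` aside (p. 384: the factor of a domain is written with
`− 2p₀(g_{j(Z)})` split off); other events reserve nothing. [folklore] -/
noncomputable def reserve (e : PEv) : ℝ := if e.kind = 0 then 2 * p0Profile C.A₀ C.p₀ (g e.step) else 0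

/-- **THE MERGER EXTENSION**: the floor over the merger window `[M, M + W e)` beyond the later partner reach `M`, plus the
merger's connector size cost over its whole epoch. [folklore] -/
noncomputable def extn (X Y : Gen PEv) (e : PEv) : ℝ :=
  ∑ n ∈ Finset.Ico (max (X.reach (dictW R C.n₁)) (Y.reach (dictW R C.n₁)))
      (max (X.reach (dictW R C.n₁)) (Y.reach (dictW R C.n₁)) + dictW R C.n₁ e), floorK C K R n +
    ∑ n ∈ supp C e, sz C K R e n

variable {C K R g}

/-! ### kind-wise values -/

/-- a birth's window is `fatWait d′ + R_s + 1` (the dictionary's table, by kind). [folklore] -/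
theorem dictW_kind0 {n₁ : ℕ} {e : PEv} (h : e.kind = 0) : dictW R n₁ e = fatWait e.fat + R e.step + 1 := by
  simp [dictW, h]
/-- a renewal's window is `R_s + 1`. [folklore] -/
theorem dictW_kind1 {n₁ : ℕ} {e : PEv} (h : e.kind = 1) : dictW R n₁ e = R e.step + 1 := by
  simp [dictW, h]
/-- a merger's window is `n₁ + R_s`. [folklore] -/
theorem dictW_kind2 {n₁ : ℕ} {e : PEv} (h : e.kind = 2) : dictW R n₁ e = n₁ + R e.step := by
  simp [dictW, h]
/-- a birth's size weight is `d′ + 1`. [folklore] -/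
theorem wt_kind0 {e : PEv} (h : e.kind = 0) : wt C e = (e.fat : ℝ) + 1 := by simp [wt, h]
/-- a merger's size weight is the connector class `dC`. [folklore] -/
theorem wt_kind2 {e : PEv} (h : e.kind = 2) : wt C e = (C.dC : ℝ) := by simp [wt, h]
/-- a birth's size epoch lasts `fatWait d′` steps. [folklore] -/
theorem fw_kind0 {e : PEv} (h : e.kind = 0) : fw C e = fatWait e.fat := by simp [fw, h]
/-- a renewal has no size epoch. [folklore] -/
theorem fw_kind1 {e : PEv} (h : e.kind = 1) : fw C e = 0 := by simp [fw, h]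
/-- a merger's size epoch lasts `fatWait dC` steps. [folklore] -/
theorem fw_kind2 {e : PEv} (h : e.kind = 2) : fw C e = fatWait C.dC := by simp [fw, h]
/-- a birth's raw credit is the (1.79) exponent. [folklore] -/
theorem credit_kind0 {e : PEv} (h : e.kind = 0) :
    credit C g e = C.a * (p0Profile C.A₀ C.p₀ (g e.step)) ^ 2 * ((e.fat : ℝ) + 1) +
      2 * p0Profile C.A₀ C.p₀ (g e.step) := by
  simp [credit, h]
/-- a renewal's raw credit is `p₀(g_h)`, `h + 1` its step. [folklore] -/
theorem credit_kind1 {e : PEv} (h : e.kind = 1) : credit C g e = p0Profile C.A₀ C.p₀ (g (e.step - 1)) := by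
  simp [credit, h]
/-- a merger carries no raw credit. [folklore] -/
theorem credit_kind2 {e : PEv} (h : e.kind = 2) : credit C g e = 0 := by simp [credit, h]
/-- a birth's bank margin is `Eb + μ(d′+1)`. [folklore] -/
theorem Emarg_kind0 {e : PEv} (h : e.kind = 0) : Emarg C e = C.Eb + C.μ * ((e.fat : ℝ) + 1) := by simp [Emarg, h]
/-- a renewal's bank margin is `E₀`. [folklore] -/
theorem Emarg_kind1 {e : PEv} (h : e.kind = 1) : Emarg C e = C.E₀ := by simp [Emarg, h]
/-- a merger's bank margin is `E₀`. [folklore] -/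
theorem Emarg_kind2 {e : PEv} (h : e.kind = 2) : Emarg C e = C.E₀ := by simp [Emarg, h]
/-- a birth's reserve is `2p₀(g_j)`. [folklore] -/
theorem reserve_kind0 {e : PEv} (h : e.kind = 0) : reserve C g e = 2 * p0Profile C.A₀ C.p₀ (g e.step) := by
  simp [reserve, h]

/-! ### nonnegativity and the window bounds through (2.9) -/

/-- the floor is nonnegative. [folklore] -/
theorem floorK_nonneg (hE₂ : 0 ≤ C.E₂) (n : ℕ) : 0 ≤ floorK C K R n := by
  unfold floorK; split_ifs <;> positivity

/-- size weights are nonnegative. [folklore] -/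
theorem wt_nonneg (C : Consts) (e : PEv) : 0 ≤ wt C e := by
  unfold wt; split_ifs <;> positivity

/-- size costs are nonnegative. [folklore] -/
theorem sz_nonneg (hE₃ : 0 ≤ C.E₃) (e : PEv) (n : ℕ) : 0 ≤ sz C K R e n := by
  unfold sz
  split_ifs
  · have := wt_nonneg C e; positivity
  · exact le_rfl

/-- an event's size cost vanishes off its size epoch. [folklore] -/
theorem sz_eq_zero_of_not_mem {e : PEv} {n : ℕ} (h : n ∉ supp C e) : sz C K R e n = 0 := by
  simp [sz, h]

/-- the window floor is nonnegative. [folklore] -/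
theorem wfloor_nonneg (hE₂ : 0 ≤ C.E₂) (p : ℕ) (e : PEv) (n : ℕ) : 0 ≤ wfloor C K R p e n := by
  unfold wfloor
  split_ifs
  · exact floorK_nonneg hE₂ n
  · exact le_rfl

/-- inside its window an event books the floor, [folklore] -/
theorem wfloor_of_mem {p : ℕ} {e : PEv} {n : ℕ} (h : n ∈ Finset.Ico p (p + dictW R C.n₁ e)) :
    wfloor C K R p e n = floorK C K R n := by
  unfold wfloor
  rw [if_pos h]

/-- outside its window it books no floor — [folklore] -/
theorem wfloor_of_not_mem {p : ℕ} {e : PEv} {n : ℕ} (h : n ∉ Finset.Ico p (p + dictW R C.n₁ e)) :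
    wfloor C K R p e n = 0 := by
  unfold wfloor
  rw [if_neg h]

/-- in particular before the window opens [folklore] -/
theorem wfloor_of_lt {p : ℕ} {e : PEv} {n : ℕ} (h : n < p) : wfloor C K R p e n = 0 :=
  wfloor_of_not_mem fun hn => absurd (Finset.mem_Ico.1 hn).1 (not_le.2 h)

/-- and from its end on. [folklore] -/
theorem wfloor_of_le {p : ℕ} {e : PEv} {n : ℕ} (h : p + dictW R C.n₁ e ≤ n) : wfloor C K R p e n = 0 :=
  wfloor_of_not_mem fun hn => absurd (Finset.mem_Ico.1 hn).2 (not_lt.2 h)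

/-- Over any set of steps containing the window, an event's window floor sums to the floor over the window. [folklore] -/
theorem sum_wfloor_eq {p : ℕ} {e : PEv} {T : Finset ℕ} (h : Finset.Ico p (p + dictW R C.n₁ e) ⊆ T) :
    ∑ n ∈ T, wfloor C K R p e n = ∑ n ∈ Finset.Ico p (p + dictW R C.n₁ e), floorK C K R n := by
  rw [← Finset.sum_subset h fun n _ hn => wfloor_of_not_mem hn]
  exact Finset.sum_congr rfl fun n hn => wfloor_of_mem hn

/-- per-step control costs are nonnegative. [folklore] -/
theorem cost_nonneg (hE₂ : 0 ≤ C.E₂) (hE₃ : 0 ≤ C.E₃) (G : Gen PEv) (n : ℕ) : 0 ≤ cost C K R G n :=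
  Finset.sum_nonneg fun e _ => add_nonneg (wfloor_nonneg hE₂ _ e n) (sz_nonneg hE₃ e n)

/-- **A BARE REGION BOOKS ITS OWN WINDOW FLOOR AND SIZE COST.** [folklore] -/
theorem cost_born (b : PEv) (j n : ℕ) : cost C K R (Gen.born b j) n = wfloor C K R j b n + sz C K R b n := by
  simp [cost]

/-- **A RENEWED COMPONENT BOOKS THE OLD COMPONENT'S COSTS PLUS THE RENEWAL'S OWN WINDOW FLOOR** (and its size cost, `0`
for a consistent renewal): the per-event booking is additive, the renewal being a new event (`e ∉ G.events`, `Gen.WF`)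
whose window opens at `h + 1` while the old events keep their placements. [folklore] -/
theorem cost_renew_eq {G : Gen PEv} {e : PEv} (he : e ∉ G.events) (h n : ℕ) :
    cost C K R (Gen.renew G e h) n = cost C K R G n + (wfloor C K R (h + 1) e n + sz C K R e n) := by
  have hsum : ∑ e' ∈ G.events, (wfloor C K R ((Gen.renew G e h).place (dictW R C.n₁) e') e' n + sz C K R e' n) =
      ∑ e' ∈ G.events, (wfloor C K R (G.place (dictW R C.n₁) e') e' n + sz C K R e' n) :=
    Finset.sum_congr rfl fun e' he' => by
      have hne : e' ≠ e := fun hq => he (hq ▸ he')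
      rw [Gen.place_renew, if_neg hne]
  unfold cost
  rw [Gen.events_renew, Finset.sum_insert he, Gen.place_renew_self, hsum]
  ring

/-- **A MERGED COMPONENT BOOKS BOTH PARTNERS' COSTS PLUS THE MERGER'S OWN WINDOW FLOOR AND CONNECTOR**: additivity over the
partners' disjoint event sets (`Gen.WF`), the partners' events keeping their placements and the merger's window placed
at the later partner reach.  Two structures coexisting before the merger thus book a floor each, and after it the
merged structure books both until their horizons — print's «This implies that d′_n(S^{n−j−1}(Z)) ≤ d′_n(S^{n−j−1}(X)) +
d′_n(S^{n−j−1}(Y)).» (p. 387, F-T4-49) read inside (ID-a). [folklore] -/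
theorem cost_merge_eq {X Y : Gen PEv} {e : PEv} (heX : e ∉ X.events) (heY : e ∉ Y.events)
    (hXY : Disjoint X.events Y.events) (n : ℕ) :
    cost C K R (Gen.merge X Y e) n = cost C K R X n + cost C K R Y n +
      (wfloor C K R (max (X.reach (dictW R C.n₁)) (Y.reach (dictW R C.n₁))) e n + sz C K R e n) := by
  have he : e ∉ X.events ∪ Y.events := by simp [heX, heY]
  have hX : ∑ e' ∈ X.events, (wfloor C K R ((Gen.merge X Y e).place (dictW R C.n₁) e') e' n + sz C K R e' n) =
      ∑ e' ∈ X.events, (wfloor C K R (X.place (dictW R C.n₁) e') e' n + sz C K R e' n) :=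
    Finset.sum_congr rfl fun e' he' => by
      have hne : e' ≠ e := fun hq => heX (hq ▸ he')
      rw [Gen.place_merge, if_neg hne, if_pos he']
  have hY : ∑ e' ∈ Y.events, (wfloor C K R ((Gen.merge X Y e).place (dictW R C.n₁) e') e' n + sz C K R e' n) =
      ∑ e' ∈ Y.events, (wfloor C K R (Y.place (dictW R C.n₁) e') e' n + sz C K R e' n) :=
    Finset.sum_congr rfl fun e' he' => by
      have hne : e' ≠ e := fun hq => heY (hq ▸ he')
      rw [Gen.place_merge, if_neg hne, if_neg (Finset.disjoint_right.1 hXY he')]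
  unfold cost
  rw [Gen.events_merge, Finset.sum_insert he, Finset.sum_union hXY, Gen.place_merge_self, hX, hY]
  ring

/-- **ONE FLOOR PER LIFE STEP** (v1.2; the dictionary's cover theorem `Gen.cover`): at every step of a well-formed
structure's life `[rootStep, reach)` the placed window of one of its events is open, so the booked cost charges at least
the floor of that step — the per-structure, per-step shape of the (1.80) summand, which the history-tree comparison of
§7 (`treeFloor_le_treeCost`) sums over the whole history. [folklore] -/
theorem floorK_le_cost (hE₂ : 0 ≤ C.E₂) (hE₃ : 0 ≤ C.E₃) {G : Gen PEv} (hW : G.WF (dictW R C.n₁)) {n : ℕ}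
    (hn : n ∈ life (dictW R C.n₁) G) : floorK C K R n ≤ cost C K R G n := by
  rw [mem_life] at hn
  obtain ⟨e, he, h1, h2⟩ := G.cover (dictW R C.n₁) hW n hn.1 hn.2
  unfold cost
  calc floorK C K R n = wfloor C K R (G.place (dictW R C.n₁) e) e n :=
        (wfloor_of_mem (Finset.mem_Ico.2 ⟨h1, h2⟩)).symm
    _ ≤ wfloor C K R (G.place (dictW R C.n₁) e) e n + sz C K R e n := le_add_of_nonneg_right (sz_nonneg hE₃ e n)
    _ ≤ ∑ e' ∈ G.events, (wfloor C K R (G.place (dictW R C.n₁) e') e' n + sz C K R e' n) :=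
        Finset.single_le_sum (f := fun e' => wfloor C K R (G.place (dictW R C.n₁) e') e' n + sz C K R e' n)
          (fun e' _ => add_nonneg (wfloor_nonneg hE₂ _ _ _) (sz_nonneg hE₃ _ _)) he

/-- The floor at any step `n ≥ s` is at most `E₂·(L·R_s)^{q′}`: (2.9) first member for `s < n ≤ K`, `L ≥ 1` at `n = s`,
and `0` beyond the cutoff. [folklore] -/
theorem floorK_le {L : ℕ} {β' β₀ : ℝ} (h29 : B14FlowStep.FlowIneq29 R g L β' β₀ K) (hL : 1 ≤ L) (hE₂ : 0 ≤ C.E₂)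
    {s n : ℕ} (hsn : s ≤ n) : floorK C K R n ≤ C.E₂ * ((L : ℝ) * R s) ^ C.q' := by
  unfold floorK
  split_ifs with hnK
  · apply mul_le_mul_of_nonneg_left _ hE₂
    apply pow_le_pow_left₀ (Nat.cast_nonneg _)
    rcases Nat.lt_or_ge s n with hlt | hge
    · exact (h29 s n hlt hnK).1
    · have hns : n = s := le_antisymm hge hsn
      subst hns
      have hL1 : (1 : ℝ) ≤ L := by exact_mod_cast hL
      calc (R n : ℝ) = 1 * R n := (one_mul _).symm
        _ ≤ L * R n := mul_le_mul_of_nonneg_right hL1 (Nat.cast_nonneg _)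
  · positivity

/-- A set of steps `≥ s` costs at most its size times `E₂·(L·R_s)^{q′}` in floor. [folklore] -/
theorem sum_floorK_le {L : ℕ} {β' β₀ : ℝ} (h29 : B14FlowStep.FlowIneq29 R g L β' β₀ K) (hL : 1 ≤ L) (hE₂ : 0 ≤ C.E₂)
    {s : ℕ} {T : Finset ℕ} (hT : ∀ n ∈ T, s ≤ n) :
    ∑ n ∈ T, floorK C K R n ≤ (T.card : ℝ) * (C.E₂ * ((L : ℝ) * R s) ^ C.q') := by
  calc ∑ n ∈ T, floorK C K R n ≤ ∑ n ∈ T, C.E₂ * ((L : ℝ) * R s) ^ C.q' :=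
        Finset.sum_le_sum fun n hn => floorK_le h29 hL hE₂ (hT n hn)
    _ = _ := by rw [Finset.sum_const, nsmul_eq_mul]

/-- On its epoch an event's size cost at step `n` is at most `E₃·(L·R_s)^{q′}·wt e·2^{−(n−s)}` ((2.9), `s < n ≤ K`).
[folklore] -/
theorem sz_le {L : ℕ} {β' β₀ : ℝ} (h29 : B14FlowStep.FlowIneq29 R g L β' β₀ K) (hE₃ : 0 ≤ C.E₃) {e : PEv} {n : ℕ}
    (hn : n ∈ supp C e) :
    sz C K R e n ≤ C.E₃ * ((L : ℝ) * R e.step) ^ C.q' * wt C e * (1 / 2 : ℝ) ^ (n - e.step) := by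
  have hw := wt_nonneg C e
  unfold sz
  split_ifs with h
  · obtain ⟨-, hnK⟩ := h
    have hsn : e.step < n := (Finset.mem_Ioc.1 hn).1
    have hR := (h29 e.step n hsn hnK).1
    apply mul_le_mul_of_nonneg_right _ (by positivity)
    apply mul_le_mul_of_nonneg_right _ hw
    exact mul_le_mul_of_nonneg_left (pow_le_pow_left₀ (Nat.cast_nonneg _) hR _) hE₃
  · positivity

/-- **AN EVENT'S WHOLE SIZE COST IS AT MOST `E₃·(L·R_s)^{q′}·wt e`** — the decayed sum «O(1)3(126)^dM^dL^{d+1}R_j^{d+1}d′_j(Z)»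
of (1.81) p. 385 in symbols: (2.9) and `Σ 2^{−(n−s)} ≤ 1` (`…T4PersistentHistoryCount.sum_half_pow_Ioc`). [folklore] -/
theorem sum_supp_sz_le {L : ℕ} {β' β₀ : ℝ} (h29 : B14FlowStep.FlowIneq29 R g L β' β₀ K) (hE₃ : 0 ≤ C.E₃) (e : PEv) :
    ∑ n ∈ supp C e, sz C K R e n ≤ C.E₃ * ((L : ℝ) * R e.step) ^ C.q' * wt C e := by
  have hgeom : ∑ n ∈ supp C e, (1 / 2 : ℝ) ^ (n - e.step) ≤ 1 := by
    unfold supp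
    rw [sum_half_pow_Ioc]
    have : (0 : ℝ) ≤ (1 / 2 : ℝ) ^ fw C e := by positivity
    linarith
  have h0 : 0 ≤ C.E₃ * ((L : ℝ) * R e.step) ^ C.q' * wt C e := by
    have := wt_nonneg C e; positivity
  calc ∑ n ∈ supp C e, sz C K R e n
      ≤ ∑ n ∈ supp C e, C.E₃ * ((L : ℝ) * R e.step) ^ C.q' * wt C e * (1 / 2 : ℝ) ^ (n - e.step) :=
        Finset.sum_le_sum fun n hn => sz_le h29 hE₃ hn
    _ = C.E₃ * ((L : ℝ) * R e.step) ^ C.q' * wt C e * ∑ n ∈ supp C e, (1 / 2 : ℝ) ^ (n - e.step) := by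
        rw [Finset.mul_sum]
    _ ≤ C.E₃ * ((L : ℝ) * R e.step) ^ C.q' * wt C e * 1 := mul_le_mul_of_nonneg_left hgeom h0
    _ = _ := mul_one _

/-- … hence over ANY set of steps. [folklore] -/
theorem sum_sz_le {L : ℕ} {β' β₀ : ℝ} (h29 : B14FlowStep.FlowIneq29 R g L β' β₀ K) (hE₃ : 0 ≤ C.E₃) (e : PEv)
    (T : Finset ℕ) : ∑ n ∈ T, sz C K R e n ≤ C.E₃ * ((L : ℝ) * R e.step) ^ C.q' * wt C e :=
  (sum_le_sum_of_vanish (sz_nonneg hE₃ e) fun _ hn => sz_eq_zero_of_not_mem hn).trans (sum_supp_sz_le h29 hE₃ e)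

end Shapes

/-! ## §3 Admissibility: print's discipline of histories, read (ID), and its invariants -/

section Admissible

variable (C : Consts) (K : ℕ) (R : ℕ → ℕ)

/-- **CONSISTENT GENEALOGIES** — the admissibility predicate handed to `Banking`: a birth event has kind `0` and sits at
its own step `j ≤ K`; a renewal event has kind `1`, step `h + 1 ≤ K`, and happens AT READINESS `h + 1 = reach` (p. 383
conditions (i), (ii); «hence K = R_{j+1} for Z» p. 386); a merger event has kind `2` and a step `≤ K` lying in both
partners' pending lives `[rootStep, reach)` (both are domains of the merger step).  Hereditary by construction.
[folklore] -/
def Consistent : Gen PEv → Prop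
  | Gen.born b j => b.kind = 0 ∧ b.step = j ∧ j ≤ K
  | Gen.renew G e h => Consistent G ∧ e.kind = 1 ∧ e.step = h + 1 ∧ h + 1 = G.reach (dictW R C.n₁) ∧ h + 1 ≤ K
  | Gen.merge X Y e => Consistent X ∧ Consistent Y ∧ e.kind = 2 ∧
      X.rootStep ≤ e.step ∧ e.step < X.reach (dictW R C.n₁) ∧
      Y.rootStep ≤ e.step ∧ e.step < Y.reach (dictW R C.n₁) ∧ e.step ≤ K

variable {C K R}

/-- A consistent genealogy is born no later than it ends. [folklore] -/
theorem Consistent.rootStep_le_reach :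
    ∀ {G : Gen PEv}, Consistent C K R G → G.rootStep ≤ G.reach (dictW R C.n₁)
  | Gen.born b j, _ => by simp
  | Gen.renew G e h, hc => by
      simp only [Consistent] at hc
      obtain ⟨hG, -, -, hr, -⟩ := hc
      have := Consistent.rootStep_le_reach hG
      simp only [Gen.rootStep_renew, Gen.reach_renew]
      omega
  | Gen.merge X Y e, hc => by
      simp only [Consistent] at hc
      obtain ⟨-, -, -, hx, hx', -, -, -⟩ := hc
      simp only [Gen.rootStep_merge, Gen.reach_merge]
      omega

/-- **EVERY EVENT'S SIZE EPOCH LIES INSIDE THE STRUCTURE'S OWN LIFE**: for a consistent genealogy and each of its events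
`e`, `rootStep ≤ e.step` and `e.step + fw e < reach` — births end their fat epoch inside their own window («Thus K ≤ n₀ −
j + R_j» p. 385), renewal AT READINESS makes the reach monotone, and the connector epoch fits the merger allowance
(`fatWait dC ≤ n₁`). [folklore] -/
theorem Consistent.event_window (hdC : fatWait C.dC ≤ C.n₁) :
    ∀ {G : Gen PEv}, Consistent C K R G → ∀ e ∈ G.events,
      G.rootStep ≤ e.step ∧ e.step + fw C e < G.reach (dictW R C.n₁)
  | Gen.born b j, hc, e, he => by
      simp only [Consistent] at hc
      obtain ⟨hk, hs, -⟩ := hc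
      simp only [Gen.events_born, Finset.mem_singleton] at he
      subst he
      simp only [Gen.rootStep_born, Gen.reach_born]
      rw [dictW_kind0 hk, fw_kind0 hk]
      omega
  | Gen.renew G e h, hc, e', he' => by
      simp only [Consistent] at hc
      obtain ⟨hG, hk, hs, hr, -⟩ := hc
      simp only [Gen.events_renew, Finset.mem_insert] at he'
      simp only [Gen.rootStep_renew, Gen.reach_renew]
      have hroot := Consistent.rootStep_le_reach hG
      rcases he' with rfl | he'
      · rw [fw_kind1 hk, dictW_kind1 hk]
        omega
      · have := Consistent.event_window hdC hG e' he'
        omega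
  | Gen.merge X Y e, hc, e', he' => by
      simp only [Consistent] at hc
      obtain ⟨hX, hY, hk, hx, hx', hy, hy', -⟩ := hc
      simp only [Gen.events_merge, Finset.mem_insert, Finset.mem_union] at he'
      simp only [Gen.rootStep_merge, Gen.reach_merge]
      rcases he' with rfl | he' | he'
      · rw [fw_kind2 hk, dictW_kind2 hk]
        omega
      · have := Consistent.event_window hdC hX e' he'
        omega
      · have := Consistent.event_window hdC hY e' he'
        omega

/-- **THE ROOT OF A CONSISTENT GENEALOGY IS A BIRTH AT `rootStep`** («j(Z) is the index of a first large field region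
contained in Z» p. 384, in the ledger). [folklore] -/
theorem Consistent.root_spec :
    ∀ {G : Gen PEv}, Consistent C K R G → G.root.kind = 0 ∧ G.root.step = G.rootStep
  | Gen.born b j, hc => by
      simp only [Consistent] at hc
      exact ⟨by simpa using hc.1, by simpa using hc.2.1⟩
  | Gen.renew G e h, hc => by
      simp only [Consistent] at hc
      simpa using Consistent.root_spec hc.1
  | Gen.merge X Y e, hc => by
      simp only [Consistent] at hc
      obtain ⟨hX, hY, -⟩ := hc
      have h1 := Consistent.root_spec hX
      have h2 := Consistent.root_spec hY
      rw [root_merge, Gen.rootStep_merge]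
      split_ifs with h
      · exact ⟨h1.1, by rw [h1.2, min_eq_left h]⟩
      · exact ⟨h2.1, by rw [h2.2, min_eq_right (not_le.mp h).le]⟩

/-- The absorbed root of a consistent merger is a birth no later than the merger step. [folklore] -/
theorem Consistent.absorbed_spec {X Y : Gen PEv} {e : PEv} (hc : Consistent C K R (Gen.merge X Y e)) :
    (absorbed X Y).kind = 0 ∧ (absorbed X Y).step ≤ e.step := by
  simp only [Consistent] at hc
  obtain ⟨hX, hY, -, hx, -, hy, -, -⟩ := hc
  unfold absorbed
  split_ifs
  · exact ⟨(Consistent.root_spec hY).1, by rw [(Consistent.root_spec hY).2]; exact hy⟩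
  · exact ⟨(Consistent.root_spec hX).1, by rw [(Consistent.root_spec hX).2]; exact hx⟩

/-- **EVERY EVENT'S WINDOW OPENS NO EARLIER THAN THE ROOT BIRTH** (v1.1): births at their own step, a renewal's window
at readiness `h + 1 = reach ≥ rootStep`, the merger's window at the later partner reach. [folklore] -/
theorem Consistent.rootStep_le_place :
    ∀ {G : Gen PEv}, Consistent C K R G → ∀ e ∈ G.events, G.rootStep ≤ G.place (dictW R C.n₁) e
  | Gen.born b j, _, e, _ => le_rfl
  | Gen.renew G e h, hc, e', he' => by
      simp only [Consistent] at hc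
      obtain ⟨hG, -, -, hr, -⟩ := hc
      have hroot := Consistent.rootStep_le_reach hG
      rw [Gen.rootStep_renew, Gen.place_renew]
      split_ifs with h1
      · omega
      · rw [Gen.events_renew, Finset.mem_insert] at he'
        exact Consistent.rootStep_le_place hG e' (he'.resolve_left h1)
  | Gen.merge X Y e, hc, e', he' => by
      simp only [Consistent] at hc
      obtain ⟨hX, hY, -, hx, hx', -, -, -⟩ := hc
      rw [Gen.rootStep_merge, Gen.place_merge]
      split_ifs with h1 h2
      · have := le_max_left (X.reach (dictW R C.n₁)) (Y.reach (dictW R C.n₁))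
        omega
      · exact (min_le_left _ _).trans (Consistent.rootStep_le_place hX e' h2)
      · rw [Gen.events_merge, Finset.mem_insert, Finset.mem_union] at he'
        have he'Y : e' ∈ Y.events := by tauto
        exact (min_le_right _ _).trans (Consistent.rootStep_le_place hY e' he'Y)

/-- **EVERY EVENT'S WINDOW CLOSES NO LATER THAN THE REACH** (v1.1): a birth's by rule (L1); under renewal AT READINESS
(`h + 1 = reach`) the old windows close where the renewal's opens, and the renewal's closes at the new reach (L2); the
partners' windows by the later partner reach and the merger's own at the merged reach (L3). [folklore] -/
theorem Consistent.place_add_le_reach :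
    ∀ {G : Gen PEv}, Consistent C K R G → ∀ e ∈ G.events,
      G.place (dictW R C.n₁) e + dictW R C.n₁ e ≤ G.reach (dictW R C.n₁)
  | Gen.born b j, _, e, he => by
      simp only [Gen.events_born, Finset.mem_singleton] at he
      subst he
      simp
  | Gen.renew G e h, hc, e', he' => by
      simp only [Consistent] at hc
      obtain ⟨hG, -, -, hr, -⟩ := hc
      rw [Gen.reach_renew, Gen.place_renew]
      split_ifs with h1
      · subst h1
        exact le_rfl
      · rw [Gen.events_renew, Finset.mem_insert] at he'
        have := Consistent.place_add_le_reach hG e' (he'.resolve_left h1)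
        omega
  | Gen.merge X Y e, hc, e', he' => by
      simp only [Consistent] at hc
      obtain ⟨hX, hY, -⟩ := hc
      rw [Gen.reach_merge, Gen.place_merge]
      split_ifs with h1 h2
      · subst h1
        exact le_rfl
      · have := Consistent.place_add_le_reach hX e' h2
        have := le_max_left (X.reach (dictW R C.n₁)) (Y.reach (dictW R C.n₁))
        omega
      · rw [Gen.events_merge, Finset.mem_insert, Finset.mem_union] at he'
        have he'Y : e' ∈ Y.events := by tauto
        have := Consistent.place_add_le_reach hY e' he'Y
        have := le_max_right (X.reach (dictW R C.n₁)) (Y.reach (dictW R C.n₁))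
        omega

/-- **THE BOOKED COST LIVES ON THE LIFE** (v1.1): off `[rootStep, reach)` a consistent structure books nothing — every
event's window (`rootStep_le_place`, `place_add_le_reach`) and size epoch (`event_window`) lies inside the life.
[folklore] -/
theorem Consistent.cost_eq_zero (hdC : fatWait C.dC ≤ C.n₁) {G : Gen PEv} (hc : Consistent C K R G) {n : ℕ}
    (hn : n ∉ life (dictW R C.n₁) G) : cost C K R G n = 0 := by
  rw [mem_life, not_and_or, not_le, not_lt] at hn
  unfold cost
  refine Finset.sum_eq_zero fun e he => ?_
  have h1 := Consistent.rootStep_le_place hc e he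
  have h2 := Consistent.place_add_le_reach hc e he
  have h3 := Consistent.event_window hdC hc e he
  have hw : n ∉ Finset.Ico (G.place (dictW R C.n₁) e) (G.place (dictW R C.n₁) e + dictW R C.n₁ e) := by
    rw [Finset.mem_Ico]
    omega
  have hs : n ∉ supp C e := by
    simp only [supp, Finset.mem_Ioc]
    omega
  rw [wfloor_of_not_mem hw, sz_eq_zero_of_not_mem hs, add_zero]

end Admissible

/-! ## §4 The printed shapes inhabit `Banking` given (2.9) and the three scale-indexed pay inequalities -/

section Inhabit

variable {C : Consts} {K L : ℕ} {R : ℕ → ℕ} {g : ℕ → ℝ} {β' β₀ : ℝ}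

/-- Arithmetic of the birth case: with window length `Wr ≤ 3·D·P` (`D = d′+1 ≥ 1`, `P = R_j ≥ 1`), the window floor, the
size cost, the bank and the margins are below `(Eb + μ + (3E₂L^{q′} + E₃L^{q′} + 3κ₁)·P^{q′+1})·D`. [folklore] -/
theorem born_arith {Wr P D Lq E₂ E₃ κ₁ Eb μ : ℝ} (hP : 1 ≤ P) (hD : 1 ≤ D) (hLq : 0 ≤ Lq) (hE₂ : 0 ≤ E₂)
    (hE₃ : 0 ≤ E₃) (hκ : 0 ≤ κ₁) (hEb : 0 ≤ Eb) (hW : Wr ≤ 3 * D * P) (q : ℕ) :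
    Wr * (E₂ * (Lq * P ^ q)) + E₃ * (Lq * P ^ q) * D + (κ₁ * Wr + (Eb + μ * D)) ≤
      (Eb + μ + (3 * E₂ * Lq + E₃ * Lq + 3 * κ₁) * P ^ (q + 1)) * D := by
  have hP0 : 0 ≤ P := by linarith
  have hD0 : 0 ≤ D := by linarith
  have hPq : P ^ q ≤ P ^ (q + 1) := pow_le_pow_right₀ hP (Nat.le_succ q)
  have hP1 : P ≤ P ^ (q + 1) := le_self_pow₀ hP (Nat.succ_ne_zero q)
  have t1 : Wr * (E₂ * (Lq * P ^ q)) ≤ (3 * D * P) * (E₂ * (Lq * P ^ q)) :=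
    mul_le_mul_of_nonneg_right hW (by positivity)
  have e1 : (3 * D * P) * (E₂ * (Lq * P ^ q)) = 3 * E₂ * Lq * P ^ (q + 1) * D := by ring
  have t2 : E₃ * (Lq * P ^ q) * D ≤ E₃ * (Lq * P ^ (q + 1)) * D :=
    mul_le_mul_of_nonneg_right (mul_le_mul_of_nonneg_left (mul_le_mul_of_nonneg_left hPq hLq) hE₃) hD0
  have t3 : κ₁ * Wr ≤ κ₁ * (3 * D * P) := mul_le_mul_of_nonneg_left hW hκ
  have t4 : κ₁ * (3 * D * P) ≤ κ₁ * (3 * D * P ^ (q + 1)) :=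
    mul_le_mul_of_nonneg_left (mul_le_mul_of_nonneg_left hP1 (by positivity)) hκ
  have t5 : Eb ≤ Eb * D := le_mul_of_one_le_right hEb hD
  rw [e1] at t1
  nlinarith [t1, t2, t3, t4, t5]

/-- Arithmetic of the renewal case: `(P + 1)·E₂L^{q′}P^{q′} ≤ 2E₂L^{q′}P^{q′+1}` for `P ≥ 1`. [folklore] -/
theorem renew_arith {P Lq E₂ : ℝ} (hP : 1 ≤ P) (hLq : 0 ≤ Lq) (hE₂ : 0 ≤ E₂) (q : ℕ) :
    (P + 1) * (E₂ * (Lq * P ^ q)) ≤ 2 * E₂ * Lq * P ^ (q + 1) := by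
  have hP0 : 0 ≤ P := by linarith
  have t1 : (P + 1) * (E₂ * (Lq * P ^ q)) ≤ (2 * P) * (E₂ * (Lq * P ^ q)) :=
    mul_le_mul_of_nonneg_right (by linarith) (by positivity)
  have e1 : (2 * P) * (E₂ * (Lq * P ^ q)) = 2 * E₂ * Lq * P ^ (q + 1) := by ring
  linarith [t1, e1]

/-- Arithmetic of the merger case: `(n₁ + P)·E₂L^{q′}P^{q′} + E₃L^{q′}P^{q′}·dC ≤ ((1+n₁)E₂L^{q′} + dC·E₃L^{q′})·P^{q′+1}` for
`P ≥ 1`. [folklore] -/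
theorem merge_arith {P Lq E₂ E₃ n₁ dC : ℝ} (hP : 1 ≤ P) (hLq : 0 ≤ Lq) (hE₂ : 0 ≤ E₂) (hE₃ : 0 ≤ E₃) (hn : 0 ≤ n₁)
    (hd : 0 ≤ dC) (q : ℕ) :
    (n₁ + P) * (E₂ * (Lq * P ^ q)) + E₃ * (Lq * P ^ q) * dC ≤
      ((1 + n₁) * E₂ * Lq + dC * E₃ * Lq) * P ^ (q + 1) := by
  have hP0 : 0 ≤ P := by linarith
  have hPq : P ^ q ≤ P ^ (q + 1) := pow_le_pow_right₀ hP (Nat.le_succ q)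
  have t1 : (n₁ + P) * (E₂ * (Lq * P ^ q)) ≤ ((1 + n₁) * P) * (E₂ * (Lq * P ^ q)) :=
    mul_le_mul_of_nonneg_right (by nlinarith) (by positivity)
  have e1 : ((1 + n₁) * P) * (E₂ * (Lq * P ^ q)) = (1 + n₁) * E₂ * Lq * P ^ (q + 1) := by ring
  have t2 : E₃ * (Lq * P ^ q) * dC ≤ E₃ * (Lq * P ^ (q + 1)) * dC :=
    mul_le_mul_of_nonneg_right (mul_le_mul_of_nonneg_left (mul_le_mul_of_nonneg_left hPq hLq) hE₃) hd
  rw [e1] at t1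
  nlinarith [t1, t2]

/-- **BIRTH**: a consistent bare region's (1.79) exponent pays its own epoch `[j, j + W b)` (floor through (2.9) + its
whole size cost), keeps the bank `κ₁W b + Eb + μ(d′+1)` and the reserve `2p₀(g_j)` — given the scale-indexed birth
inequality `Hb` (= the conclusion of `…T4BankedInduction.birthFactor_pays`). [folklore] -/
theorem born_holds (hC : C.Valid) (h29 : B14FlowStep.FlowIneq29 R g L β' β₀ K) (hL : 1 ≤ L)
    (hR1 : ∀ s, s ≤ K → 1 ≤ R s)
    (Hb : ∀ s, s ≤ K → ∀ d' : ℕ,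
      (C.Eb + C.μ + (3 * C.E₂ * (L : ℝ) ^ C.q' + C.E₃ * (L : ℝ) ^ C.q' + 3 * C.κ₁) * (R s : ℝ) ^ (C.q' + 1)) *
          ((d' : ℝ) + 1) + 2 * p0Profile C.A₀ C.p₀ (g s) ≤
        C.a * (p0Profile C.A₀ C.p₀ (g s)) ^ 2 * ((d' : ℝ) + 1) + 2 * p0Profile C.A₀ C.p₀ (g s))
    (b : PEv) (j : ℕ) (hc : Consistent C K R (Gen.born b j)) :
    ∑ n ∈ Finset.Ico j (j + dictW R C.n₁ b), cost C K R (Gen.born b j) n +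
      (C.κ₁ * ((dictW R C.n₁ b : ℕ) : ℝ) + Emarg C b) + reserve C g b ≤ credit C g b := by
  simp only [Consistent] at hc
  obtain ⟨hk, hs, hjK⟩ := hc
  have hWn : dictW R C.n₁ b = fatWait b.fat + R j + 1 := by rw [dictW_kind0 hk, hs]
  rw [credit_kind0 hk, Emarg_kind0 hk, reserve_kind0 hk, hs]
  -- the cost sum = the window floor + own size cost (`cost_born`)
  have hsum : ∑ n ∈ Finset.Ico j (j + dictW R C.n₁ b), cost C K R (Gen.born b j) n =
      ∑ n ∈ Finset.Ico j (j + dictW R C.n₁ b), floorK C K R n +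
        ∑ n ∈ Finset.Ico j (j + dictW R C.n₁ b), sz C K R b n := by
    rw [← Finset.sum_add_distrib]
    exact Finset.sum_congr rfl fun n hn => by rw [cost_born, wfloor_of_mem hn]
  have hfl : ∑ n ∈ Finset.Ico j (j + dictW R C.n₁ b), floorK C K R n ≤
      (dictW R C.n₁ b : ℝ) * (C.E₂ * ((L : ℝ) * R j) ^ C.q') := by
    have h := sum_floorK_le h29 hL hC.E₂_nonneg (s := j) (T := Finset.Ico j (j + dictW R C.n₁ b))
      (fun n hn => (Finset.mem_Ico.1 hn).1)
    rwa [Nat.card_Ico, Nat.add_sub_cancel_left] at h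
  have hszs : ∑ n ∈ Finset.Ico j (j + dictW R C.n₁ b), sz C K R b n ≤
      C.E₃ * ((L : ℝ) * R j) ^ C.q' * ((b.fat : ℝ) + 1) := by
    have h := sum_sz_le h29 hC.E₃_nonneg b (Finset.Ico j (j + dictW R C.n₁ b))
    rwa [hs, wt_kind0 hk] at h
  -- window length ≤ 3 (d′+1) R_j
  have hP : (1 : ℝ) ≤ R j := by exact_mod_cast hR1 j hjK
  have hD : (1 : ℝ) ≤ (b.fat : ℝ) + 1 := by
    have : (0 : ℝ) ≤ b.fat := Nat.cast_nonneg _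
    linarith
  have hfw : (fatWait b.fat : ℝ) ≤ (b.fat : ℝ) + 1 := by
    have h1 : fatWait b.fat ≤ b.fat + 1 := by
      unfold fatWait
      have := Nat.log_le_self 2 b.fat
      omega
    exact_mod_cast h1
  have hWle : (dictW R C.n₁ b : ℝ) ≤ 3 * ((b.fat : ℝ) + 1) * R j := by
    rw [hWn]
    push_cast
    nlinarith
  have key := born_arith (Lq := (L : ℝ) ^ C.q') (E₂ := C.E₂) (E₃ := C.E₃) (κ₁ := C.κ₁) (Eb := C.Eb) (μ := C.μ)
    hP hD (by positivity) hC.E₂_nonneg hC.E₃_nonneg hC.κ₁_nonneg hC.Eb_nonneg hWle C.q'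
  have hb := Hb j hjK b.fat
  rw [mul_pow] at hfl hszs
  rw [hsum]
  linarith

/-- **RENEWAL, PAST**: at the steps `n ≤ h` before its window opens the renewed component books exactly the old
component's costs — the renewal is a new event (`Gen.WF`) carrying no size (v1.1: equality; the binder asks `≤`).
[folklore] -/
theorem renew_past_eq (G : Gen PEv) (e : PEv) (h : ℕ) (hc : Consistent C K R (Gen.renew G e h))
    (hW : (Gen.renew G e h).WF (dictW R C.n₁)) (n : ℕ) (hn : n ≤ h) :
    cost C K R (Gen.renew G e h) n = cost C K R G n := by
  simp only [Consistent] at hc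
  obtain ⟨-, hk, -, -, -⟩ := hc
  simp only [Gen.WF] at hW
  obtain ⟨-, he, -, -⟩ := hW
  have h0 : sz C K R e n = 0 := sz_eq_zero_of_not_mem (by simp [supp, fw_kind1 hk])
  rw [cost_renew_eq he, wfloor_of_lt (by omega : n < h + 1), h0, add_zero, add_zero]

/-- **RENEWAL, PAST** (the binder's shape): up to the readiness step the renewed component costs no more than the old
one. [folklore] -/
theorem renew_past_holds (G : Gen PEv) (e : PEv) (h : ℕ) (hc : Consistent C K R (Gen.renew G e h))
    (hW : (Gen.renew G e h).WF (dictW R C.n₁)) (n : ℕ) (hn : n ≤ h) :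
    cost C K R (Gen.renew G e h) n ≤ cost C K R G n :=
  (renew_past_eq G e h hc hW n hn).le

/-- **RENEWAL**: at readiness the old component's booked cost is over (its windows and epochs end at the old reach
`h + 1`, `Consistent.cost_eq_zero`), so in the new window `[h+1, h+2+R_{h+1})` the renewed component costs exactly the
floor («K = R_{j+1} for Z» p. 386); the factor `p₀(g_h)` pays it and the bank — given the scale-indexed renewal
inequality `Hr` (= the conclusion of `…T4BankedInduction.renewalFactor_pays`). [folklore] -/
theorem renew_holds (hC : C.Valid) (h29 : B14FlowStep.FlowIneq29 R g L β' β₀ K) (hL : 1 ≤ L)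
    (hR1 : ∀ s, s ≤ K → 1 ≤ R s)
    (Hr : ∀ h, h + 1 ≤ K →
      2 * C.E₂ * (L : ℝ) ^ C.q' * (R (h + 1) : ℝ) ^ (C.q' + 1) + (C.κ₁ * ((R (h + 1) : ℝ) + 1) + C.E₀) ≤
        p0Profile C.A₀ C.p₀ (g h))
    (G : Gen PEv) (e : PEv) (h : ℕ) (hc : Consistent C K R (Gen.renew G e h))
    (hW : (Gen.renew G e h).WF (dictW R C.n₁)) :
    ∑ n ∈ Finset.Ico (h + 1) (h + 1 + dictW R C.n₁ e), cost C K R (Gen.renew G e h) n +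
      (C.κ₁ * ((dictW R C.n₁ e : ℕ) : ℝ) + Emarg C e) ≤ credit C g e := by
  have hc' := hc
  simp only [Consistent] at hc'
  obtain ⟨hG, hk, hs, hr, hK⟩ := hc'
  have hW' := hW
  simp only [Gen.WF] at hW'
  obtain ⟨-, he, -, -⟩ := hW'
  have hWn : dictW R C.n₁ e = R (h + 1) + 1 := by rw [dictW_kind1 hk, hs]
  have hcr : credit C g e = p0Profile C.A₀ C.p₀ (g h) := by rw [credit_kind1 hk, hs, Nat.add_sub_cancel]
  rw [hcr, Emarg_kind1 hk]
  -- inside the new window the cost is the floor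
  have hcost : ∀ n ∈ Finset.Ico (h + 1) (h + 1 + dictW R C.n₁ e), cost C K R (Gen.renew G e h) n = floorK C K R n := by
    intro n hn
    have hn1 : h + 1 ≤ n := (Finset.mem_Ico.1 hn).1
    have hG0 : cost C K R G n = 0 := Consistent.cost_eq_zero hC.dC_le hG (by rw [mem_life]; omega)
    have hsz : sz C K R e n = 0 := sz_eq_zero_of_not_mem (by simp [supp, fw_kind1 hk])
    rw [cost_renew_eq he, hG0, wfloor_of_mem hn, hsz, zero_add, add_zero]
  rw [Finset.sum_congr rfl hcost]
  have hfl := sum_floorK_le h29 hL hC.E₂_nonneg (s := h + 1) (T := Finset.Ico (h + 1) (h + 1 + dictW R C.n₁ e))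
    (fun n hn => (Finset.mem_Ico.1 hn).1)
  rw [Nat.card_Ico, Nat.add_sub_cancel_left, hWn, mul_pow] at hfl
  push_cast at hfl
  have hP : (1 : ℝ) ≤ R (h + 1) := by exact_mod_cast hR1 (h + 1) hK
  have key := renew_arith (Lq := (L : ℝ) ^ C.q') (E₂ := C.E₂) hP (by positivity) hC.E₂_nonneg C.q'
  have hpay := Hr h hK
  rw [hWn]
  push_cast
  linarith

/-- **MERGER, GEOMETRY — EXACT** (v1.1): the merged structure's life cost IS the two partners' life costs plus the
extension.  The per-event booking is additive over the partners' disjoint event sets (`cost_merge_eq`); each partner's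
booked cost lives on its own life, which lies inside the merged life (`Consistent.cost_eq_zero`); the merger's window
`[M, M + W e)` beyond the later reach `M` and its connector epoch lie inside the merged life (`Consistent.event_window`).
(1.88) first inequality + absorption p. 387, in the model, with equality. [folklore] -/
theorem lifeCost_merge_eq (hC : C.Valid) (X Y : Gen PEv) (e : PEv) (hc : Consistent C K R (Gen.merge X Y e))
    (hW : (Gen.merge X Y e).WF (dictW R C.n₁)) :
    lifeCost (dictW R C.n₁) (cost C K R) (Gen.merge X Y e) =
      lifeCost (dictW R C.n₁) (cost C K R) X + lifeCost (dictW R C.n₁) (cost C K R) Y + extn C K R X Y e := by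
  have hc' := hc
  simp only [Consistent] at hc'
  obtain ⟨hX, hY, -, hx, hx', hy, hy', -⟩ := hc'
  have hW' := hW
  simp only [Gen.WF] at hW'
  obtain ⟨-, -, heX, heY, hXY, -, -⟩ := hW'
  have hrX := Consistent.rootStep_le_reach hX
  -- the partners' lives, the merger's window and its epoch lie inside the merged life
  have hLX : life (dictW R C.n₁) X ⊆ life (dictW R C.n₁) (Gen.merge X Y e) := fun n hn => by
    rw [mem_life] at hn ⊢
    rw [Gen.rootStep_merge, Gen.reach_merge]
    constructor <;> omega
  have hLY : life (dictW R C.n₁) Y ⊆ life (dictW R C.n₁) (Gen.merge X Y e) := fun n hn => by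
    rw [mem_life] at hn ⊢
    rw [Gen.rootStep_merge, Gen.reach_merge]
    constructor <;> omega
  have hLM : Finset.Ico (max (X.reach (dictW R C.n₁)) (Y.reach (dictW R C.n₁)))
      (max (X.reach (dictW R C.n₁)) (Y.reach (dictW R C.n₁)) + dictW R C.n₁ e) ⊆
        life (dictW R C.n₁) (Gen.merge X Y e) := fun n hn => by
    rw [Finset.mem_Ico] at hn
    rw [mem_life, Gen.rootStep_merge, Gen.reach_merge]
    constructor <;> omega
  have hLS : ∀ n ∈ supp C e, n ∈ life (dictW R C.n₁) (Gen.merge X Y e) := fun n hn => by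
    have hw := Consistent.event_window hC.dC_le hc e (by simp)
    simp only [supp, Finset.mem_Ioc] at hn
    rw [mem_life]
    constructor <;> omega
  -- the partial sums over the merged life
  have hsumX : ∑ n ∈ life (dictW R C.n₁) (Gen.merge X Y e), cost C K R X n = ∑ n ∈ life (dictW R C.n₁) X, cost C K R X n :=
    (Finset.sum_subset hLX fun n _ hn => Consistent.cost_eq_zero hC.dC_le hX hn).symm
  have hsumY : ∑ n ∈ life (dictW R C.n₁) (Gen.merge X Y e), cost C K R Y n = ∑ n ∈ life (dictW R C.n₁) Y, cost C K R Y n :=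
    (Finset.sum_subset hLY fun n _ hn => Consistent.cost_eq_zero hC.dC_le hY hn).symm
  have hsumS : ∑ n ∈ life (dictW R C.n₁) (Gen.merge X Y e), sz C K R e n = ∑ n ∈ supp C e, sz C K R e n :=
    (Finset.sum_subset (fun n hn => hLS n hn) fun n _ hn => sz_eq_zero_of_not_mem hn).symm
  unfold lifeCost extn
  rw [Finset.sum_congr rfl fun n _ => cost_merge_eq heX heY hXY n, Finset.sum_add_distrib, Finset.sum_add_distrib,
    Finset.sum_add_distrib, hsumX, hsumY, sum_wfloor_eq hLM, hsumS]

/-- **MERGER, GEOMETRY** (the binder): the merged structure's life cost is at most the partners' life costs plus the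
extension — by the exact decomposition `lifeCost_merge_eq`. [folklore] -/
theorem merge_geom_holds (hC : C.Valid) (X Y : Gen PEv) (e : PEv) (hc : Consistent C K R (Gen.merge X Y e))
    (hW : (Gen.merge X Y e).WF (dictW R C.n₁)) :
    lifeCost (dictW R C.n₁) (cost C K R) (Gen.merge X Y e) ≤
      lifeCost (dictW R C.n₁) (cost C K R) X + lifeCost (dictW R C.n₁) (cost C K R) Y + extn C K R X Y e :=
  (lifeCost_merge_eq hC X Y e hc hW).le

/-- **MERGER, PAY**: the absorbed root — a birth at a step `m ≤ s` — releases its reserve `2p₀(g_m)`, which pays the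
extension (floor over the `n₁ + R_s` window beyond the later reach, through (2.9), plus the connector) and the merger's
bank `κ₁(n₁ + R_s) + E₀` — given the scale-indexed merger inequality `Hm` (= the conclusion of
`…T4BankedInduction.mergeSurplus_pays`). [folklore] -/
theorem merge_pay_holds (hC : C.Valid) (h29 : B14FlowStep.FlowIneq29 R g L β' β₀ K) (hL : 1 ≤ L)
    (hR1 : ∀ s, s ≤ K → 1 ≤ R s)
    (Hm : ∀ m s, m ≤ s → s ≤ K →
      ((1 + C.n₁) * C.E₂ * (L : ℝ) ^ C.q' + C.dC * C.E₃ * (L : ℝ) ^ C.q') * (R s : ℝ) ^ (C.q' + 1) +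
          (C.κ₁ * ((C.n₁ : ℝ) + R s) + C.E₀) ≤ 2 * p0Profile C.A₀ C.p₀ (g m))
    (X Y : Gen PEv) (e : PEv) (hc : Consistent C K R (Gen.merge X Y e)) :
    extn C K R X Y e + (C.κ₁ * ((dictW R C.n₁ e : ℕ) : ℝ) + Emarg C e) ≤
      reserve C g (absorbed X Y) + credit C g e := by
  have hab := Consistent.absorbed_spec hc
  have hc' := hc
  simp only [Consistent] at hc'
  obtain ⟨-, -, hk, -, hx', -, -, hsK⟩ := hc'
  have hWn : dictW R C.n₁ e = C.n₁ + R e.step := dictW_kind2 hk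
  unfold extn
  rw [credit_kind2 hk, Emarg_kind2 hk, reserve_kind0 hab.1, hWn]
  have hfl : ∑ n ∈ Finset.Ico (max (X.reach (dictW R C.n₁)) (Y.reach (dictW R C.n₁)))
        (max (X.reach (dictW R C.n₁)) (Y.reach (dictW R C.n₁)) + (C.n₁ + R e.step)), floorK C K R n ≤
      ((C.n₁ + R e.step : ℕ) : ℝ) * (C.E₂ * ((L : ℝ) * R e.step) ^ C.q') := by
    have h := sum_floorK_le h29 hL hC.E₂_nonneg (s := e.step)
      (T := Finset.Ico (max (X.reach (dictW R C.n₁)) (Y.reach (dictW R C.n₁)))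
        (max (X.reach (dictW R C.n₁)) (Y.reach (dictW R C.n₁)) + (C.n₁ + R e.step)))
      (fun n hn => by
        have h1 := (Finset.mem_Ico.1 hn).1
        have h2 : e.step < max (X.reach (dictW R C.n₁)) (Y.reach (dictW R C.n₁)) :=
          lt_of_lt_of_le hx' (le_max_left _ _)
        omega)
    rwa [Nat.card_Ico, Nat.add_sub_cancel_left] at h
  have hszs : ∑ n ∈ supp C e, sz C K R e n ≤ C.E₃ * ((L : ℝ) * R e.step) ^ C.q' * C.dC := by
    have h := sum_supp_sz_le h29 hC.E₃_nonneg e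
    rwa [wt_kind2 hk] at h
  rw [mul_pow] at hfl hszs
  push_cast at hfl
  have hP : (1 : ℝ) ≤ R e.step := by exact_mod_cast hR1 e.step hsK
  have key := merge_arith (Lq := (L : ℝ) ^ C.q') (E₂ := C.E₂) (E₃ := C.E₃) (n₁ := (C.n₁ : ℝ)) (dC := (C.dC : ℝ))
    hP (by positivity) hC.E₂_nonneg hC.E₃_nonneg (Nat.cast_nonneg _) (Nat.cast_nonneg _) C.q'
  have hpay := Hm (absorbed X Y).step e.step hab.2 hsK
  push_cast
  linarith

/-- **THE PRINTED SHAPES INHABIT `Banking`.**  For valid constants, along a run obeying the typed (2.9) first member with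
`1 ≤ R s`, the three scale-indexed pay inequalities — conclusions of `…T4BankedInduction.birthFactor_pays`,
`renewalFactor_pays`, `mergeSurplus_pays` — make the printed-shape data satisfy all four binders of
`…T4BankedInduction.Banking` with admissibility `Consistent` (the merger geometry exactly, `lifeCost_merge_eq`).  Hence
(`banked_induction`) every consistent well-formed genealogy has `lifeCost + banks + reserve root ≤ credits`. [folklore] -/
theorem banking_printedShape (hC : C.Valid) (h29 : B14FlowStep.FlowIneq29 R g L β' β₀ K) (hL : 1 ≤ L)
    (hR1 : ∀ s, s ≤ K → 1 ≤ R s)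
    (Hb : ∀ s, s ≤ K → ∀ d' : ℕ,
      (C.Eb + C.μ + (3 * C.E₂ * (L : ℝ) ^ C.q' + C.E₃ * (L : ℝ) ^ C.q' + 3 * C.κ₁) * (R s : ℝ) ^ (C.q' + 1)) *
          ((d' : ℝ) + 1) + 2 * p0Profile C.A₀ C.p₀ (g s) ≤
        C.a * (p0Profile C.A₀ C.p₀ (g s)) ^ 2 * ((d' : ℝ) + 1) + 2 * p0Profile C.A₀ C.p₀ (g s))
    (Hr : ∀ h, h + 1 ≤ K →
      2 * C.E₂ * (L : ℝ) ^ C.q' * (R (h + 1) : ℝ) ^ (C.q' + 1) + (C.κ₁ * ((R (h + 1) : ℝ) + 1) + C.E₀) ≤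
        p0Profile C.A₀ C.p₀ (g h))
    (Hm : ∀ m s, m ≤ s → s ≤ K →
      ((1 + C.n₁) * C.E₂ * (L : ℝ) ^ C.q' + C.dC * C.E₃ * (L : ℝ) ^ C.q') * (R s : ℝ) ^ (C.q' + 1) +
          (C.κ₁ * ((C.n₁ : ℝ) + R s) + C.E₀) ≤ 2 * p0Profile C.A₀ C.p₀ (g m)) :
    Banking (Consistent C K R) (dictW R C.n₁) (cost C K R) (credit C g)
      (fun e => C.κ₁ * ((dictW R C.n₁ e : ℕ) : ℝ) + Emarg C e) (reserve C g) (extn C K R) where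
  cost_nonneg := cost_nonneg hC.E₂_nonneg hC.E₃_nonneg
  adm_renew G e h hc := by
    simp only [Consistent] at hc
    exact hc.1
  adm_merge X Y e hc := by
    simp only [Consistent] at hc
    exact ⟨hc.1, hc.2.1⟩
  born b j hc := born_holds hC h29 hL hR1 Hb b j hc
  renew_past G e h hc hW n hn := renew_past_holds G e h hc hW n hn
  renew G e h hc hW := renew_holds hC h29 hL hR1 Hr G e h hc hW
  merge_geom X Y e hc hW := merge_geom_holds hC X Y e hc hW
  merge_pay X Y e hc _ := merge_pay_holds hC h29 hL hR1 Hm X Y e hc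

end Inhabit

/-! ## §5 From the typed flow: the pay inequalities by name, and ONE infrared threshold for every cutoff -/

section Flow

variable {C : Consts} {K L r : ℕ} {R : ℕ → ℕ} {g : ℕ → ℝ} {β' β₀ : ℝ}

/-- Along a run with (2.5) windows and `L ≥ 1`, every window is at least `1` (`R_s = L^t`). [folklore] -/
theorem one_le_R (hR : ∀ s, s ≤ K → B14.IsRj L r (g s) (R s)) (hL : 1 ≤ L) : ∀ s, s ≤ K → 1 ≤ R s := by
  intro s hs
  obtain ⟨t, ht, -, -⟩ := hR s hs
  rw [ht]
  exact Nat.one_le_pow _ _ hL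

/-- **THE BINDERS FROM THE TYPED FLOW.**  Typed (2.7) `B14.FlowIneq27`, typed (2.9) `B14FlowStep.FlowIneq29`, typed (2.5)
`B14.IsRj` along the run, the exponent conditions `r ≤ p₀`, `r(q′+1) ≤ p₀` (the cell's (X7) at `q′ = d + 1`),
`1 ≤ log g_s⁻²`, and — ON THE INFRARED VALUE `log g_K⁻²` ONLY — two γ-clauses per case with budgets `(1+β₀)(c₁+c₂) ≤ 1`
(renewal: the factor `p₀(g_h)` pays at scale `h+1`), `(1+β₀)(c₃+c₄) ≤ 2` (merger: the surplus «2(1 + β₀)^{−1}p₀(g_{j+1})»)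
and the birth threshold `(1+β₀)(c₅+c₆) ≤ a·p₀(g_K)` («This condition is satisfied for p₀ large, and g₁ sufficiently
small.» shape of `birthCredit_dominates`): then the printed-shape data inhabit `Banking`.  The three pay inequalities are
supplied by `birthFactor_pays`, `renewalFactor_pays`, `mergeSurplus_pays` by name. [folklore] -/
theorem banking_printedShape_of_flow {c₁ c₂ c₃ c₄ c₅ c₆ : ℝ} (hC : C.Valid) (ha : 0 ≤ C.a) (hA : 0 ≤ C.A₀)
    (h27 : B14.FlowIneq27 g β' β₀ C.p₀ K) (h29 : B14FlowStep.FlowIneq29 R g L β' β₀ K)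
    (hR : ∀ s, s ≤ K → B14.IsRj L r (g s) (R s))
    (hrp : r ≤ C.p₀) (hrq : r * (C.q' + 1) ≤ C.p₀) (hL : 1 ≤ L) (hβ : 0 ≤ β₀)
    (hc₁ : 0 ≤ c₁) (hc₂ : 0 ≤ c₂) (hc₃ : 0 ≤ c₃) (hc₄ : 0 ≤ c₄) (hc₅ : 0 ≤ c₅) (hc₆ : 0 ≤ c₆)
    (hx1 : ∀ s, s ≤ K → 1 ≤ Real.log ((g s) ^ 2)⁻¹)
    (hγ₁ : (L : ℝ) * (1 + β₀) * (2 * C.κ₁ + C.E₀) ≤ c₁ * C.A₀ * (Real.log ((g K) ^ 2)⁻¹) ^ (C.p₀ - r))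
    (hγ₂ : (L : ℝ) ^ (C.q' + 1) * (1 + β₀) * (2 * C.E₂ * (L : ℝ) ^ C.q') ≤
      c₂ * C.A₀ * (Real.log ((g K) ^ 2)⁻¹) ^ (C.p₀ - r * (C.q' + 1)))
    (hb₁ : (1 + β₀) * (c₁ + c₂) ≤ 1)
    (hγ₃ : (L : ℝ) * (1 + β₀) * ((1 + (C.n₁ : ℝ)) * C.κ₁ + C.E₀) ≤
      c₃ * C.A₀ * (Real.log ((g K) ^ 2)⁻¹) ^ (C.p₀ - r))
    (hγ₄ : (L : ℝ) ^ (C.q' + 1) * (1 + β₀) * ((1 + C.n₁) * C.E₂ * (L : ℝ) ^ C.q' + C.dC * C.E₃ * (L : ℝ) ^ C.q') ≤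
      c₄ * C.A₀ * (Real.log ((g K) ^ 2)⁻¹) ^ (C.p₀ - r * (C.q' + 1)))
    (hb₂ : (1 + β₀) * (c₃ + c₄) ≤ 2)
    (hγ₅ : (L : ℝ) * (1 + β₀) * (C.Eb + C.μ) ≤ c₅ * C.A₀ * (Real.log ((g K) ^ 2)⁻¹) ^ (C.p₀ - r))
    (hγ₆ : (L : ℝ) ^ (C.q' + 1) * (1 + β₀) * (3 * C.E₂ * (L : ℝ) ^ C.q' + C.E₃ * (L : ℝ) ^ C.q' + 3 * C.κ₁) ≤
      c₆ * C.A₀ * (Real.log ((g K) ^ 2)⁻¹) ^ (C.p₀ - r * (C.q' + 1)))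
    (hthr : (1 + β₀) * (c₅ + c₆) ≤ C.a * p0Profile C.A₀ C.p₀ (g K)) :
    Banking (Consistent C K R) (dictW R C.n₁) (cost C K R) (credit C g)
      (fun e => C.κ₁ * ((dictW R C.n₁ e : ℕ) : ℝ) + Emarg C e) (reserve C g) (extn C K R) := by
  have hR1 := one_le_R hR hL
  have hx0 : ∀ s, s ≤ K → 0 ≤ Real.log ((g s) ^ 2)⁻¹ := fun s hs => by linarith [hx1 s hs]
  refine banking_printedShape hC h29 hL hR1 ?_ ?_ ?_
  · -- births: `credit_dominates_window_poly` (κ₁ := 0) feeds `birthFactor_pays`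
    have hpoly : ∀ s, s ≤ K →
        C.Eb + C.μ + (3 * C.E₂ * (L : ℝ) ^ C.q' + C.E₃ * (L : ℝ) ^ C.q' + 3 * C.κ₁) * (R s : ℝ) ^ (C.q' + 1) ≤
          (c₅ + c₆) * p0Profile C.A₀ C.p₀ (g s) := by
      intro s hs
      have h := credit_dominates_window_poly (κ₁ := 0) (F := 0) (W := R) (E₀ := C.Eb + C.μ)
        (E₁ := 3 * C.E₂ * (L : ℝ) ^ C.q' + C.E₃ * (L : ℝ) ^ C.q' + 3 * C.κ₁) (q := C.q' + 1)
        h27 hR hrp hrq hL hβ hA hc₅ hc₆ (add_nonneg hC.Eb_nonneg hC.μ_nonneg) le_rfl hx1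
        (fun s _ => by simp) (by simpa using hγ₅) hγ₆ s hs
      linarith
    exact birthFactor_pays (E_f := C.Eb) (μ := C.μ) h27 hβ hA ha hx0 hpoly hthr
  · -- renewals
    have hW : ∀ s, s ≤ K → (((fun s => R s + 1) s : ℕ) : ℝ) ≤ (1 + 1) * R s := by
      intro s hs
      have : (1 : ℝ) ≤ R s := by exact_mod_cast hR1 s hs
      push_cast
      linarith
    have hγ₁' : (L : ℝ) * (1 + β₀) * ((1 + 1) * C.κ₁ + C.E₀) ≤
        c₁ * C.A₀ * (Real.log ((g K) ^ 2)⁻¹) ^ (C.p₀ - r) := by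
      rw [one_add_one_eq_two]; exact hγ₁
    have h := renewalFactor_pays (W := fun s => R s + 1) (F := 1) (E₁ := 2 * C.E₂ * (L : ℝ) ^ C.q')
      (q := C.q' + 1) h27 hR hrp hrq hL hβ hA hc₁ hc₂ hC.E₀_nonneg hC.κ₁_nonneg hx1 hW hγ₁' hγ₂ hb₁
    intro k hk
    have := h k hk
    push_cast at this
    linarith
  · -- mergers
    have hW : ∀ s, s ≤ K → (((fun s => C.n₁ + R s) s : ℕ) : ℝ) ≤ (1 + (C.n₁ : ℝ)) * R s := by
      intro s hs
      have : (1 : ℝ) ≤ R s := by exact_mod_cast hR1 s hs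
      have hn : (0 : ℝ) ≤ C.n₁ := Nat.cast_nonneg _
      push_cast
      nlinarith
    have h := mergeSurplus_pays (W := fun s => C.n₁ + R s) (F := (C.n₁ : ℝ))
      (E₁ := (1 + C.n₁) * C.E₂ * (L : ℝ) ^ C.q' + C.dC * C.E₃ * (L : ℝ) ^ C.q') (q := C.q' + 1)
      h27 hR hrp hrq hL hβ hA hc₃ hc₄ hC.E₀_nonneg hC.κ₁_nonneg hx1 hW hγ₃ hγ₄ hb₂
    intro m s hms hs
    have := h m s hms hs
    push_cast at this
    linarith

/-- **ONE INFRARED THRESHOLD, EVERY CUTOFF** — «for p₀ large and γ small enough» ((1.88) p. 387) and «This condition is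
satisfied for p₀ large, and g₁ sufficiently small.» ((1.82) p. 385) made exact and JOINT: for valid symbolic constants
with `a, A₀ > 0`, block size `L ≥ 1`, `β₀ ≥ 0` and the exponent condition `r(q′+1) < p₀` ((X7)), there is a number `x₀`
— depending on these only, NOT on the cutoff — such that along EVERY run `(g s, R s)_{s ≤ K}` of the typed flow
((2.7), (2.9), (2.5), `1 ≤ log g_s⁻²`) whose infrared value satisfies `log g_K⁻² ≥ x₀`, the printed-shape data inhabit
`Banking (Consistent C K R) …`. [folklore] -/
theorem exists_irThreshold (C : Consts) (hC : C.Valid) (ha : 0 < C.a) (hA : 0 < C.A₀) {L r : ℕ} (hL : 1 ≤ L)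
    {β₀ : ℝ} (hβ : 0 ≤ β₀) (hrq : r * (C.q' + 1) < C.p₀) :
    ∃ x₀ : ℝ, ∀ (K : ℕ) (R : ℕ → ℕ) (g : ℕ → ℝ) (β' : ℝ),
      B14.FlowIneq27 g β' β₀ C.p₀ K → B14FlowStep.FlowIneq29 R g L β' β₀ K →
      (∀ s, s ≤ K → B14.IsRj L r (g s) (R s)) → (∀ s, s ≤ K → 1 ≤ Real.log ((g s) ^ 2)⁻¹) →
      x₀ ≤ Real.log ((g K) ^ 2)⁻¹ →
        Banking (Consistent C K R) (dictW R C.n₁) (cost C K R) (credit C g)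
          (fun e => C.κ₁ * ((dictW R C.n₁ e : ℕ) : ℝ) + Emarg C e) (reserve C g) (extn C K R) := by
  have hrp : r < C.p₀ := lt_of_le_of_lt (Nat.le_mul_of_pos_right r (Nat.succ_pos _)) hrq
  have hb0 : (0 : ℝ) < 1 + β₀ := by linarith
  have hcR : 0 < 1 / (2 * (1 + β₀)) * C.A₀ := by positivity
  have hcM : 0 < 1 / (1 + β₀) * C.A₀ := by positivity
  have hc1 : 0 < (1 : ℝ) * C.A₀ := by simpa using hA
  obtain ⟨x₁, hx₁⟩ := exists_threshold_poly (β₀ := β₀) (F := 1) (E₀ := C.E₀)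
    (E₁ := 2 * C.E₂ * (L : ℝ) ^ C.q') (κ₁ := C.κ₁) (L := L) (q := C.q' + 1) hrp hrq hcR hcR
  obtain ⟨x₂, hx₂⟩ := exists_threshold_poly (β₀ := β₀) (F := (C.n₁ : ℝ)) (E₀ := C.E₀)
    (E₁ := (1 + C.n₁) * C.E₂ * (L : ℝ) ^ C.q' + C.dC * C.E₃ * (L : ℝ) ^ C.q') (κ₁ := C.κ₁) (L := L)
    (q := C.q' + 1) hrp hrq hcM hcM
  obtain ⟨x₃, hx₃⟩ := exists_threshold_poly (β₀ := β₀) (F := 0) (E₀ := C.Eb + C.μ)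
    (E₁ := 3 * C.E₂ * (L : ℝ) ^ C.q' + C.E₃ * (L : ℝ) ^ C.q' + 3 * C.κ₁) (κ₁ := 0) (L := L)
    (q := C.q' + 1) hrp hrq hc1 hc1
  refine ⟨max (max x₁ x₂) (max x₃ (max 1 (2 * (1 + β₀) / (C.a * C.A₀)))), ?_⟩
  intro K R g β' h27 h29 hR hx1 hxK
  have hK₁ : x₁ ≤ Real.log ((g K) ^ 2)⁻¹ := le_trans ((le_max_left _ _).trans (le_max_left _ _)) hxK
  have hK₂ : x₂ ≤ Real.log ((g K) ^ 2)⁻¹ := le_trans ((le_max_right _ _).trans (le_max_left _ _)) hxK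
  have hK₃ : x₃ ≤ Real.log ((g K) ^ 2)⁻¹ := le_trans ((le_max_left _ _).trans (le_max_right _ _)) hxK
  have hK₄ : max 1 (2 * (1 + β₀) / (C.a * C.A₀)) ≤ Real.log ((g K) ^ 2)⁻¹ :=
    le_trans ((le_max_right _ _).trans (le_max_right _ _)) hxK
  obtain ⟨hγ₁, hγ₂⟩ := hx₁ _ hK₁
  obtain ⟨hγ₃, hγ₄⟩ := hx₂ _ hK₂
  obtain ⟨hγ₅, hγ₆⟩ := hx₃ _ hK₃
  have hthr : (1 + β₀) * (1 + 1) ≤ C.a * p0Profile C.A₀ C.p₀ (g K) := by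
    have h := gammaClause_of_large (B := 2 * (1 + β₀)) (n := C.p₀) (mul_pos ha hA) (by omega) hK₄
    unfold p0Profile
    linarith
  have hb₁ : (1 + β₀) * (1 / (2 * (1 + β₀)) + 1 / (2 * (1 + β₀))) ≤ 1 := by
    rw [show (1 + β₀) * (1 / (2 * (1 + β₀)) + 1 / (2 * (1 + β₀))) = 1 by field_simp; ring]
  have hb₂ : (1 + β₀) * (1 / (1 + β₀) + 1 / (1 + β₀)) ≤ 2 := by
    rw [show (1 + β₀) * (1 / (1 + β₀) + 1 / (1 + β₀)) = 2 by field_simp; ring]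
  have hγ₁' : (L : ℝ) * (1 + β₀) * (2 * C.κ₁ + C.E₀) ≤
      1 / (2 * (1 + β₀)) * C.A₀ * (Real.log ((g K) ^ 2)⁻¹) ^ (C.p₀ - r) := by
    have e2 : ((1 : ℝ) + 1) * C.κ₁ = 2 * C.κ₁ := by norm_num
    rw [e2] at hγ₁
    exact hγ₁
  have hγ₅' : (L : ℝ) * (1 + β₀) * (C.Eb + C.μ) ≤ 1 * C.A₀ * (Real.log ((g K) ^ 2)⁻¹) ^ (C.p₀ - r) := by
    simpa using hγ₅
  exact banking_printedShape_of_flow hC ha.le hA.le h27 h29 hR hrp.le hrq.le hL hβ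
    (by positivity) (by positivity) (by positivity) (by positivity) zero_le_one zero_le_one hx1
    hγ₁' hγ₂ hb₁ hγ₃ hγ₄ hb₂ hγ₅' hγ₆ hthr

end Flow

/-! ## §6 The consequence in the count carrier's currency -/

section Price

variable {C : Consts} {K : ℕ} {R : ℕ → ℕ} {g : ℕ → ℝ}

/-- **EVERY CONSISTENT WELL-FORMED GENEALOGY OBEYS THE CARRIER'S PRICE SHAPE `hy`** (`…T4LiveStructureGas.exists_
relWeightBound_of_recordsGas`, `…T4PersistentHistoryCount.slotPrice_le`): once the printed shapes inhabit `Banking`,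
`e^{−credits}·e^{+lifeCost} ≤ ρ_root·e^{−κ₁W root}·∏_{e ∈ events ∖ root}(e^{−κ₁W e}·η_e)` with `ρ_b = e^{−(reserve b + E b)}
= e^{−(2p₀(g_j) + Eb + μ(d′+1))}` for the root birth and `η_e = e^{−E e}` (`= e^{−E₀}` at renewals/mergers,
`e^{−(Eb + μ(d′+1))}` at the other births) — `…T4BankedInduction.rawFactor_le_recordPrice`, by name. [folklore] -/
theorem printedShape_recordPrice
    (B : Banking (Consistent C K R) (dictW R C.n₁) (cost C K R) (credit C g)
      (fun e => C.κ₁ * ((dictW R C.n₁ e : ℕ) : ℝ) + Emarg C e) (reserve C g) (extn C K R))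
    {G : Gen PEv} (hc : Consistent C K R G) (hW : G.WF (dictW R C.n₁)) :
    Real.exp (-credits (credit C g) G) * Real.exp (lifeCost (dictW R C.n₁) (cost C K R) G) ≤
      (Real.exp (-(reserve C g G.root + Emarg C G.root)) * Real.exp (-(C.κ₁ * ((dictW R C.n₁ G.root : ℕ) : ℝ)))) *
        ∏ e ∈ G.events.erase G.root,
          (Real.exp (-(C.κ₁ * ((dictW R C.n₁ e : ℕ) : ℝ))) * Real.exp (-Emarg C e)) :=
  rawFactor_le_recordPrice B hc hW

/-- … and the root's price is the birth price of the model: `reserve root + E root = 2p₀(g_{rootStep}) + Eb + μ(d′+1)`.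
[folklore] -/
theorem root_price {G : Gen PEv} (hc : Consistent C K R G) :
    reserve C g G.root + Emarg C G.root =
      2 * p0Profile C.A₀ C.p₀ (g G.rootStep) + (C.Eb + C.μ * ((G.root.fat : ℝ) + 1)) := by
  have h := Consistent.root_spec hc
  rw [reserve_kind0 h.1, Emarg_kind0 h.1, h.2]

end Price

/-! ## §7 The history-tree booking identity (v1.1) -/

section Tree

variable (C : Consts) (K : ℕ) (R : ℕ → ℕ)

/-- **THE HISTORY-TREE BOOKING** of a genealogy up to the cut `t`: every structure of its history tree — each constituent
region while bare, each renewed component, each merged component — is charged its own modelled per-step cost `cost V n`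
from the step at which it appears (its birth step `j`; the step `h + 1` at which the renewed component appears; the
merger step `e.step`) until the step at which its successor appears, or the cut — print's (1.80) summed per domain and
per step over the whole history.  This is the booking the cross-read C-pv10-98 (O2) tested v1's life cost against.
[folklore] -/
noncomputable def treeCost : Gen PEv → ℕ → ℝ
  | Gen.born b j, t => ∑ n ∈ Finset.Ico j t, cost C K R (Gen.born b j) n
  | Gen.renew G e h, t => treeCost G (min (h + 1) t) + ∑ n ∈ Finset.Ico (h + 1) t, cost C K R (Gen.renew G e h) n
  | Gen.merge X Y e, t =>
      treeCost X (min e.step t) + treeCost Y (min e.step t) +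
        ∑ n ∈ Finset.Ico e.step t, cost C K R (Gen.merge X Y e) n

variable {C K R}

/-- **MERGER, PAST**: before the merger step the merged structure books exactly the two partners' costs — the merger's
window opens at the later partner reach `> e.step` and its connector epoch after `e.step`. [folklore] -/
theorem merge_past_eq {X Y : Gen PEv} {e : PEv} (hc : Consistent C K R (Gen.merge X Y e))
    (hW : (Gen.merge X Y e).WF (dictW R C.n₁)) {n : ℕ} (hn : n < e.step) :
    cost C K R (Gen.merge X Y e) n = cost C K R X n + cost C K R Y n := by
  simp only [Consistent] at hc
  obtain ⟨-, -, -, -, hx', -, -, -⟩ := hc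
  simp only [Gen.WF] at hW
  obtain ⟨-, -, heX, heY, hXY, -, -⟩ := hW
  have hM : n < max (X.reach (dictW R C.n₁)) (Y.reach (dictW R C.n₁)) := by
    have := le_max_left (X.reach (dictW R C.n₁)) (Y.reach (dictW R C.n₁))
    omega
  have hs : sz C K R e n = 0 := sz_eq_zero_of_not_mem (by simp only [supp, Finset.mem_Ioc]; omega)
  rw [cost_merge_eq heX heY hXY, wfloor_of_lt hM, hs, add_zero, add_zero]

/-- **THE HISTORY-TREE BOOKING IDENTITY.**  For a consistent well-formed genealogy the tree booking up to any cut EQUALS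
the structure's own booked cost summed from the root birth to the cut.  A renewed component books the old component's
costs plus its own window (`cost_renew_eq`, `renew_past_eq`); a merged component books both partners' costs plus its own
window and connector (`cost_merge_eq`, `merge_past_eq`); and a partner books nothing off its own life, in particular
nothing before its own birth (`Consistent.cost_eq_zero`).  The aggregation clause of C-pv10-98 (O2), an identity under
the per-event booking. [folklore] -/
theorem treeCost_eq (hdC : fatWait C.dC ≤ C.n₁) :
    ∀ {G : Gen PEv}, Consistent C K R G → G.WF (dictW R C.n₁) →
      ∀ t, treeCost C K R G t = ∑ n ∈ Finset.Ico G.rootStep t, cost C K R G n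
  | Gen.born b j, _, _, t => by simp [treeCost]
  | Gen.renew G e h, hc, hW, t => by
      have hc' := hc
      simp only [Consistent] at hc'
      obtain ⟨hG, -, -, hr, -⟩ := hc'
      have hW' := hW
      simp only [Gen.WF] at hW'
      obtain ⟨hGW, -, -, -⟩ := hW'
      have hroot := Consistent.rootStep_le_reach hG
      have hpast : ∀ n ∈ Finset.Ico G.rootStep (min (h + 1) t), cost C K R G n = cost C K R (Gen.renew G e h) n :=
        fun n hn => (renew_past_eq G e h hc hW n (by have := (Finset.mem_Ico.1 hn).2; omega)).symm
      simp only [treeCost]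
      rw [treeCost_eq hdC hG hGW, Gen.rootStep_renew, Finset.sum_congr rfl hpast]
      rcases Nat.lt_or_ge t (h + 1) with ht | ht
      · rw [min_eq_right ht.le, Finset.Ico_eq_empty_of_le ht.le, Finset.sum_empty, add_zero]
      · rw [min_eq_left ht]
        exact Finset.sum_Ico_consecutive _ (by omega) ht
  | Gen.merge X Y e, hc, hW, t => by
      have hc' := hc
      simp only [Consistent] at hc'
      obtain ⟨hX, hY, -, hx, -, -, -, -⟩ := hc'
      have hW' := hW
      simp only [Gen.WF] at hW'
      obtain ⟨hXW, hYW, -, -, -, -, -⟩ := hW'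
      have hXs : ∀ u, ∑ n ∈ Finset.Ico X.rootStep u, cost C K R X n =
          ∑ n ∈ Finset.Ico (min X.rootStep Y.rootStep) u, cost C K R X n := fun u =>
        Finset.sum_subset (Finset.Ico_subset_Ico_left (min_le_left _ _)) fun n hn hn' =>
          Consistent.cost_eq_zero hdC hX (by
            rw [Finset.mem_Ico] at hn hn'
            rw [mem_life]
            omega)
      have hYs : ∀ u, ∑ n ∈ Finset.Ico Y.rootStep u, cost C K R Y n =
          ∑ n ∈ Finset.Ico (min X.rootStep Y.rootStep) u, cost C K R Y n := fun u =>
        Finset.sum_subset (Finset.Ico_subset_Ico_left (min_le_right _ _)) fun n hn hn' =>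
          Consistent.cost_eq_zero hdC hY (by
            rw [Finset.mem_Ico] at hn hn'
            rw [mem_life]
            omega)
      have hpre : ∀ n ∈ Finset.Ico (min X.rootStep Y.rootStep) (min e.step t),
          cost C K R X n + cost C K R Y n = cost C K R (Gen.merge X Y e) n := fun n hn =>
        (merge_past_eq hc hW (by have := (Finset.mem_Ico.1 hn).2; omega)).symm
      simp only [treeCost]
      rw [treeCost_eq hdC hX hXW, treeCost_eq hdC hY hYW, hXs, hYs, ← Finset.sum_add_distrib,
        Finset.sum_congr rfl hpre, Gen.rootStep_merge]
      rcases Nat.lt_or_ge t e.step with ht | ht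
      · rw [min_eq_right ht.le, Finset.Ico_eq_empty_of_le ht.le, Finset.sum_empty, add_zero]
      · rw [min_eq_left ht]
        exact Finset.sum_Ico_consecutive _ (by omega) ht

/-- **… IN PARTICULAR THE TREE BOOKING OF THE WHOLE HISTORY IS THE LIFE COST** priced in §6: `treeCost G reach =
lifeCost G`. [folklore] -/
theorem treeCost_reach (hdC : fatWait C.dC ≤ C.n₁) {G : Gen PEv} (hc : Consistent C K R G)
    (hW : G.WF (dictW R C.n₁)) :
    treeCost C K R G (G.reach (dictW R C.n₁)) = lifeCost (dictW R C.n₁) (cost C K R) G := by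
  unfold lifeCost life
  exact treeCost_eq hdC hc hW _

variable (C K R) in
/-- **THE HISTORY-TREE FLOOR COUNT** up to the cut `t`: ONE floor `floorK n` per structure of the history tree and per
step, from the step at which the structure appears to the step at which its successor appears (or the cut) — the
realised quantity the cross-read C-pv10-98 §(C4) counted for its genealogy (`10`). [folklore] -/
noncomputable def treeFloor : Gen PEv → ℕ → ℝ
  | Gen.born _ j, t => ∑ n ∈ Finset.Ico j t, floorK C K R n
  | Gen.renew G _ h, t => treeFloor G (min (h + 1) t) + ∑ n ∈ Finset.Ico (h + 1) t, floorK C K R n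
  | Gen.merge X Y e, t =>
      treeFloor X (min e.step t) + treeFloor Y (min e.step t) + ∑ n ∈ Finset.Ico e.step t, floorK C K R n

/-- **THE TREE's FLOORS ARE BOOKED** (v1.2): up to any cut not beyond the reach, the history-tree floor count is at most
the history-tree booking — every structure of the tree is ALIVE on its own segment (consistency: a renewal happens at
the old reach, a merger inside both partners' lives; well-formedness: the root step precedes the renewal step), and a
living structure pays its floor (`floorK_le_cost`). [folklore] -/
theorem treeFloor_le_treeCost (hE₂ : 0 ≤ C.E₂) (hE₃ : 0 ≤ C.E₃) :
    ∀ {G : Gen PEv}, Consistent C K R G → G.WF (dictW R C.n₁) → ∀ {t : ℕ}, t ≤ G.reach (dictW R C.n₁) →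
      treeFloor C K R G t ≤ treeCost C K R G t
  | Gen.born b j, _, hW, t, ht => by
      simp only [treeFloor, treeCost]
      refine Finset.sum_le_sum fun n hn => floorK_le_cost hE₂ hE₃ hW ?_
      rw [Finset.mem_Ico] at hn
      rw [mem_life, Gen.rootStep_born]
      exact ⟨hn.1, lt_of_lt_of_le hn.2 ht⟩
  | Gen.renew G e h, hc, hW, t, ht => by
      have hc' := hc
      simp only [Consistent] at hc'
      obtain ⟨hG, -, -, hr, -⟩ := hc'
      have hW' := hW
      simp only [Gen.WF] at hW'
      obtain ⟨hGW, -, hh, -⟩ := hW'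
      simp only [treeFloor, treeCost]
      refine add_le_add (treeFloor_le_treeCost hE₂ hE₃ hG hGW ((min_le_left _ _).trans hr.le)) ?_
      refine Finset.sum_le_sum fun n hn => floorK_le_cost hE₂ hE₃ hW ?_
      rw [Finset.mem_Ico] at hn
      rw [mem_life, Gen.rootStep_renew]
      exact ⟨hh.trans (Nat.le_of_succ_le hn.1), lt_of_lt_of_le hn.2 ht⟩
  | Gen.merge X Y e, hc, hW, t, ht => by
      have hc' := hc
      simp only [Consistent] at hc'
      obtain ⟨hX, hY, -, hx, hx', hy, hy', -⟩ := hc'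
      have hW' := hW
      simp only [Gen.WF] at hW'
      obtain ⟨hXW, hYW, -⟩ := hW'
      simp only [treeFloor, treeCost]
      refine add_le_add (add_le_add
        (treeFloor_le_treeCost hE₂ hE₃ hX hXW ((min_le_left _ _).trans hx'.le))
        (treeFloor_le_treeCost hE₂ hE₃ hY hYW ((min_le_left _ _).trans hy'.le))) ?_
      refine Finset.sum_le_sum fun n hn => floorK_le_cost hE₂ hE₃ hW ?_
      rw [Finset.mem_Ico] at hn
      rw [mem_life, Gen.rootStep_merge]
      exact ⟨(min_le_left _ _).trans (hx.trans hn.1), lt_of_lt_of_le hn.2 ht⟩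

/-- **… SO THE WHOLE HISTORY's FLOOR COUNT IS PAID BY THE FINAL STRUCTURE's LIFE COST** priced in §6:
`treeFloor G reach ≤ lifeCost G` — the aggregation clause of the cross-read's repair menu (R-c), FALSE for v1's hull
booking (`10 > 9` in §(C4)), holds for the per-event booking (`treeFloor_le_treeCost` + `treeCost_reach`). [folklore] -/
theorem treeFloor_le_lifeCost (hC : C.Valid) {G : Gen PEv} (hc : Consistent C K R G) (hW : G.WF (dictW R C.n₁)) :
    treeFloor C K R G (G.reach (dictW R C.n₁)) ≤ lifeCost (dictW R C.n₁) (cost C K R) G := by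
  rw [← treeCost_reach hC.dC_le hc hW]
  exact treeFloor_le_treeCost hC.E₂_nonneg hC.E₃_nonneg hc hW le_rfl

end Tree

/-! ## §8 Non-vacuity of the admissibility, and the cross-read's genealogy re-decided -/

section Sanity

/-- With constant windows `R ≡ 2` (any constants `C`): the region `(0,0,0)` born at step `0` (window `1 + 2 + 1 = 4`,
reach `4`) is renewed AT READINESS `h + 1 = 4` by the event `(4,1,0)` (new reach `4 + 3 = 7`), and merges at step `6`
with the region `(5,0,1)` born at `5` (reach `9`) through the event `(6,2,0)`; all steps `≤ K = 10`.  This genealogy is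
`Consistent`. [folklore] -/
example (C : Consts) :
    Consistent C 10 (fun _ => 2)
      (Gen.merge (Gen.renew (Gen.born ((0, 0, 0) : PEv) 0) ((4, 1, 0) : PEv) 3)
        (Gen.born ((5, 0, 1) : PEv) 5) ((6, 2, 0) : PEv)) := by
  simp [Consistent, Gen.reach, Gen.rootStep, dictW, PEv.kind, PEv.step, PEv.fat, fatWait]

/-- … and it is well formed (`Gen.WF`) for the same window table — so the binders' joint guard `adm ∧ WF` is inhabited
by a genealogy with a renewal and a merger. [folklore] -/
example (C : Consts) :
    (Gen.merge (Gen.renew (Gen.born ((0, 0, 0) : PEv) 0) ((4, 1, 0) : PEv) 3)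
        (Gen.born ((5, 0, 1) : PEv) 5) ((6, 2, 0) : PEv)).WF (dictW (fun _ => 2) C.n₁) := by
  simp [Gen.WF, Gen.reach, Gen.rootStep, dictW, PEv.kind, PEv.fat, fatWait]

/-- … whereas a renewal BEFORE readiness (`h + 1 = 3 < 4 = reach`) is not consistent. [folklore] -/
example (C : Consts) :
    ¬ Consistent C 10 (fun _ => 2) (Gen.renew (Gen.born ((0, 0, 0) : PEv) 0) ((3, 1, 0) : PEv) 2) := by
  simp [Consistent, Gen.reach, dictW, PEv.kind, PEv.step, PEv.fat, fatWait]

/-! ### the cross-read's two-partner genealogy (C-pv10-98, `xread3/TwinC.lean` §(C4)), re-decided under the per-event booking -/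

namespace XreadC4

/-- The cross-read's floor-only constants: `n₁ = 1`, `dC = 0`, `q′ = 0`, `E₂ = 1`, every other constant `0` — with
`R ≡ 2` and `K = 10` the floor of every performed step is `1` and all size costs vanish. [folklore] -/
def C₀ : Consts where
  n₁ := 1
  dC := 0
  q' := 0
  E₂ := 1
  E₃ := 0
  κ₁ := 0
  E₀ := 0
  Eb := 0
  μ := 0
  a := 0
  A₀ := 0
  p₀ := 0

/-- `C₀` is valid (`fatWait 0 = 1 ≤ 1 = n₁`). [folklore] -/
theorem C₀_valid : C₀.Valid where
  E₂_nonneg := by norm_num [C₀]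
  E₃_nonneg := by norm_num [C₀]
  κ₁_nonneg := by norm_num [C₀]
  E₀_nonneg := by norm_num [C₀]
  Eb_nonneg := by norm_num [C₀]
  μ_nonneg := by norm_num [C₀]
  dC_le := by decide

/-- The cross-read's partners: `X₀` born at `0` (window `fatWait 0 + 2 + 1 = 4`, life `[0, 4)`) and `Y₀` born at `2`
(life `[2, 6)`), merged at step `3` by the event `(3, 2, 0)` (window `1 + 2 = 3` placed at the later reach `6`; merged
life `[0, 9)`). [folklore] -/
def X₀ : Gen PEv := Gen.born ((0, 0, 0) : PEv) 0

/-- the second partner [folklore] -/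
def Y₀ : Gen PEv := Gen.born ((2, 0, 0) : PEv) 2

/-- the merged genealogy [folklore] -/
def Z₀ : Gen PEv := Gen.merge X₀ Y₀ ((3, 2, 0) : PEv)

/-- `Z₀` is consistent … [folklore] -/
theorem Z₀_consistent : Consistent C₀ 10 (fun _ => 2) Z₀ := by
  simp [Consistent, Z₀, X₀, Y₀, C₀, Gen.reach, Gen.rootStep, dictW, PEv.kind, PEv.step, PEv.fat, fatWait]

/-- … and well formed. [folklore] -/
theorem Z₀_wf : Z₀.WF (dictW (fun _ => 2) C₀.n₁) := by
  simp [Gen.WF, Z₀, X₀, Y₀, C₀, Gen.reach, Gen.rootStep, dictW, PEv.kind, PEv.fat, fatWait]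

/-- every performed step's floor is `1` [folklore] -/
theorem floor_C₀ (n : ℕ) (hn : n ≤ 10) : floorK C₀ 10 (fun _ => 2) n = 1 := by
  simp [floorK, C₀, hn]

/-- all size costs vanish [folklore] -/
theorem sz_C₀ (e : PEv) (n : ℕ) : sz C₀ 10 (fun _ => 2) e n = 0 := by
  unfold sz
  split_ifs <;> simp [C₀]

/-- the windows: `X₀`'s is `[0, 4)`, [folklore] -/
theorem win_X₀ : Finset.Ico 0 (0 + dictW (fun _ => 2) C₀.n₁ ((0, 0, 0) : PEv)) = Finset.Ico 0 4 := by
  simp [dictW, PEv.kind, PEv.fat, fatWait]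

/-- `Y₀`'s is `[2, 6)`, [folklore] -/
theorem win_Y₀ : Finset.Ico 2 (2 + dictW (fun _ => 2) C₀.n₁ ((2, 0, 0) : PEv)) = Finset.Ico 2 6 := by
  simp [dictW, PEv.kind, PEv.fat, fatWait]

/-- the later partner reach is `6`, [folklore] -/
theorem reach_XY₀ : max (X₀.reach (dictW (fun _ => 2) C₀.n₁)) (Y₀.reach (dictW (fun _ => 2) C₀.n₁)) = 6 := by
  simp [X₀, Y₀, C₀, dictW, PEv.kind, PEv.fat, fatWait]

/-- and the merger's window is `[6, 9)`. [folklore] -/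
theorem win_Z₀ : Finset.Ico 6 (6 + dictW (fun _ => 2) C₀.n₁ ((3, 2, 0) : PEv)) = Finset.Ico 6 9 := by
  simp [C₀, dictW, PEv.kind]

/-- `X₀` books a floor `1` at each step of its window `[0, 4)` and nothing else: [folklore] -/
theorem cost_X₀ (n : ℕ) : cost C₀ 10 (fun _ => 2) X₀ n = if n < 4 then 1 else 0 := by
  rw [X₀, cost_born, sz_C₀, add_zero]
  split_ifs with h
  · rw [wfloor_of_mem (by rw [win_X₀]; simp; omega), floor_C₀ n (by omega)]
  · exact wfloor_of_not_mem (by rw [win_X₀]; simp; omega)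

/-- `Y₀` books a floor `1` at each step of `[2, 6)`: [folklore] -/
theorem cost_Y₀ (n : ℕ) : cost C₀ 10 (fun _ => 2) Y₀ n = if 2 ≤ n ∧ n < 6 then 1 else 0 := by
  rw [Y₀, cost_born, sz_C₀, add_zero]
  split_ifs with h
  · rw [wfloor_of_mem (by rw [win_Y₀]; simp; omega), floor_C₀ n (by omega)]
  · exact wfloor_of_not_mem (by rw [win_Y₀]; simp; omega)

/-- the merged structure books both partners' floors and, on `[6, 9)`, the merger's. [folklore] -/
theorem cost_Z₀ (n : ℕ) : cost C₀ 10 (fun _ => 2) Z₀ n =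
    (if n < 4 then 1 else 0) + (if 2 ≤ n ∧ n < 6 then 1 else 0) + (if 6 ≤ n ∧ n < 9 then 1 else 0) := by
  rw [Z₀, cost_merge_eq (by simp [X₀]) (by simp [Y₀]) (by simp [X₀, Y₀]), cost_X₀, cost_Y₀, reach_XY₀, sz_C₀, add_zero]
  congr 1
  split_ifs with h
  · rw [wfloor_of_mem (by rw [win_Z₀]; simp; omega), floor_C₀ n (by omega)]
  · exact wfloor_of_not_mem (by rw [win_Z₀]; simp; omega)

/-- **THE PARTNERS' LIVES COST `4` EACH** (as in the cross-read), [folklore] -/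
theorem lifeCost_X₀ : lifeCost (dictW (fun _ => 2) C₀.n₁) (cost C₀ 10 (fun _ => 2)) X₀ = 4 := by
  rw [lifeCost, show life (dictW (fun _ => 2) C₀.n₁) X₀ = Finset.Ico 0 4 by
      simp [life, X₀, C₀, dictW, PEv.kind, PEv.fat, fatWait], Finset.sum_Ico_eq_sum_range,
    show (4 - 0 : ℕ) = 4 from rfl]
  simp only [Finset.sum_range_succ, Finset.sum_range_zero, zero_add]
  norm_num [cost_X₀]

/-- the second likewise, [folklore] -/
theorem lifeCost_Y₀ : lifeCost (dictW (fun _ => 2) C₀.n₁) (cost C₀ 10 (fun _ => 2)) Y₀ = 4 := by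
  rw [lifeCost, show life (dictW (fun _ => 2) C₀.n₁) Y₀ = Finset.Ico 2 6 by
      simp [life, Y₀, C₀, dictW, PEv.kind, PEv.fat, fatWait], Finset.sum_Ico_eq_sum_range,
    show (6 - 2 : ℕ) = 4 from rfl]
  simp only [Finset.sum_range_succ, Finset.sum_range_zero, zero_add]
  norm_num [cost_Y₀]

/-- **THE EXTENSION IS `3`** (the merger window `[6, 9)`; no connector cost), [folklore] -/
theorem extn_Z₀ : extn C₀ 10 (fun _ => 2) X₀ Y₀ ((3, 2, 0) : PEv) = 3 := by
  unfold extn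
  rw [reach_XY₀, win_Z₀, Finset.sum_Ico_eq_sum_range, show (9 - 6 : ℕ) = 3 from rfl]
  simp only [Finset.sum_range_succ, Finset.sum_range_zero, zero_add]
  norm_num [floor_C₀, sz_C₀]

/-- **SO THE MERGED LIFE COSTS `4 + 4 + 3 = 11`** (`lifeCost_merge_eq`; v1 booked `9`): both pre-merger partner floors at
the steps `2, 3` and both partners' floors until their horizons are booked. [folklore] -/
theorem lifeCost_Z₀ : lifeCost (dictW (fun _ => 2) C₀.n₁) (cost C₀ 10 (fun _ => 2)) Z₀ = 11 := by
  rw [Z₀, lifeCost_merge_eq C₀_valid X₀ Y₀ _ Z₀_consistent Z₀_wf, lifeCost_X₀, lifeCost_Y₀, extn_Z₀]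
  norm_num

/-- **THE READER'S TREE FLOORS, RE-DECIDED**: `X₀` alone on `[0, 3)`, `Y₀` alone on `[2, 3)`, the merged structure on
`[3, 9)` book `3 + 1 + 7 = 11` — EQUAL to the life cost (v1: `10 > 9`). [folklore] -/
theorem treeFloors_Z₀ :
    ∑ n ∈ Finset.Ico 0 3, cost C₀ 10 (fun _ => 2) X₀ n + ∑ n ∈ Finset.Ico 2 3, cost C₀ 10 (fun _ => 2) Y₀ n +
      ∑ n ∈ Finset.Ico 3 9, cost C₀ 10 (fun _ => 2) Z₀ n = 11 := by
  rw [Finset.sum_Ico_eq_sum_range, Finset.sum_Ico_eq_sum_range, Finset.sum_Ico_eq_sum_range,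
    show (3 - 0 : ℕ) = 3 from rfl, show (3 - 2 : ℕ) = 1 from rfl, show (9 - 3 : ℕ) = 6 from rfl]
  simp only [Finset.sum_range_succ, Finset.sum_range_zero, zero_add]
  norm_num [cost_X₀, cost_Y₀, cost_Z₀]

/-- … which is `treeCost Z₀ 9` unfolded; and by the identity `treeCost_eq` the tree booking of the whole history is the
life cost: `treeCost Z₀ (reach Z₀) = lifeCost Z₀ = 11`. [folklore] -/
theorem treeCost_Z₀ : treeCost C₀ 10 (fun _ => 2) Z₀ (Z₀.reach (dictW (fun _ => 2) C₀.n₁)) = 11 := by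
  rw [treeCost_reach C₀_valid.dC_le Z₀_consistent Z₀_wf, lifeCost_Z₀]

/-- the unfolding: `treeCost Z₀ 9` is literally the reader's three-member sum. [folklore] -/
example : treeCost C₀ 10 (fun _ => 2) Z₀ 9 =
    ∑ n ∈ Finset.Ico 0 3, cost C₀ 10 (fun _ => 2) X₀ n + ∑ n ∈ Finset.Ico 2 3, cost C₀ 10 (fun _ => 2) Y₀ n +
      ∑ n ∈ Finset.Ico 3 9, cost C₀ 10 (fun _ => 2) Z₀ n := by
  rfl

/-- the reader's floor count of the history tree: `X₀` on `[0,3)`, `Y₀` on `[2,3)`, `Z₀` on `[3,9)` — `3 + 1 + 6 = 10`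
floors … [folklore] -/
theorem treeFloor_Z₀ : treeFloor C₀ 10 (fun _ => 2) Z₀ 9 = 10 := by
  simp only [treeFloor, Z₀, X₀, Y₀, PEv.step_mk]
  rw [show min 3 9 = 3 from rfl, Finset.sum_Ico_eq_sum_range, Finset.sum_Ico_eq_sum_range, Finset.sum_Ico_eq_sum_range,
    show (3 - 0 : ℕ) = 3 from rfl, show (3 - 2 : ℕ) = 1 from rfl, show (9 - 3 : ℕ) = 6 from rfl]
  simp only [Finset.sum_range_succ, Finset.sum_range_zero, zero_add]
  norm_num [floor_C₀]

/-- … paid by the final structure's life cost `11` (`treeFloor_le_lifeCost`; v1's hull booking priced `9 < 10`).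
[folklore] -/
example : treeFloor C₀ 10 (fun _ => 2) Z₀ (Z₀.reach (dictW (fun _ => 2) C₀.n₁)) ≤
    lifeCost (dictW (fun _ => 2) C₀.n₁) (cost C₀ 10 (fun _ => 2)) Z₀ :=
  treeFloor_le_lifeCost C₀_valid Z₀_consistent Z₀_wf

example : treeFloor C₀ 10 (fun _ => 2) Z₀ (Z₀.reach (dictW (fun _ => 2) C₀.n₁)) = 10 ∧
    lifeCost (dictW (fun _ => 2) C₀.n₁) (cost C₀ 10 (fun _ => 2)) Z₀ = 11 := by
  refine ⟨?_, lifeCost_Z₀⟩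
  rw [show Z₀.reach (dictW (fun _ => 2) C₀.n₁) = 9 by simp [Z₀, X₀, Y₀, C₀, dictW, PEv.kind, PEv.fat, fatWait]]
  exact treeFloor_Z₀

end XreadC4

end Sanity

end Literature.MathematicalPhysics.QuantumFieldTheory.Balaban1983to89.T4PrintedShapeBanking
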